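import Literature.NumberTheory.Sieve.GoldstonPintzYildirimTwoVarEuler
import Literature.NumberTheory.Sieve.GoldstonPintzYildirimEulerProduct
import Literature.Analysis.Complex.LocallyUniformLimitSCV
import HarnessLib

/-!
# Goldston–Pintz–Yıldırım, *Primes in tuples I*, §7 (7.9)–(7.12): the function `G(s₁,s₂)`

Trunk: NumberTheory / Sieve, continuing `GoldstonPintzYildirimTwoVarEuler` ((7.8): the Euler
product `F(s₁,s₂) = ∏_p F₂Factor_p`) and the one-variable `GoldstonPintzYildirimEulerProduct`
(`G_H`, `Δ`, `U`, (6.16)). GPY, *Primes in tuples. I* (Ann. of Math. 170 (2009) =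
arXiv:math/0508185), §7, p. 15:

* (7.9) `F(s₁,s₂) = G(s₁,s₂) ζ(1+s₁+s₂)^r / (ζ(1+s₁)^{k₁} ζ(1+s₂)^{k₂})`, `r = |H₁ ∩ H₂|`;
* (7.10) `G(s₁,s₂) = ∏_p F₂Factor_p (1 − p^{−1−s₁−s₂})^r (1 − p^{−1−s₁})^{−k₁} (1 − p^{−1−s₂})^{−k₂}`,
  "analytic and uniformly bounded for `σ₁, σ₂ > −1/4 + δ`";
* (7.11) `G(0,0) = 𝔖(H)`, `H = H₁ ∪ H₂`;
* (7.12) `G(s₁,s₂) ≪ exp(C k U^{δ₁+δ₂} log log U)` on and to the right of `𝓛`,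
  `δᵢ = −min(σᵢ, 0)`, `U = Ck² log 2h` ((6.14)), "the same argument leading to (6.16)".

Everything here is PROVED (the two-variable copy of (6.8)–(6.16) of the one-variable file):

* `Literature.NumberTheory.Sieve.GPY.G₂Factor`, `Literature.NumberTheory.Sieve.GPY.G₂` — (7.10), as an
  unconditional product over `Nat.Primes`;
* `G₂Factor_zero_zero`, `G₂_zero_zero` — **(7.11)**: `G₂Factor_p(0,0) = GFactor_{H} p 0`, so
  `G(0,0) = G_H(0) = 𝔖(H)` (`GH_zero`);
* `hasProd_G₂Factor`, `FDir₂_eq_G₂_mul` — **(7.9)** for `Re s₁, Re s₂ ≥ 1` (Euler products of `F`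
  ((7.8)) and of `ζ`);
* `Literature.NumberTheory.Sieve.GPY.g₂Log` — the logarithm `E_p` of the generic tail factor
  (`ν_p(H₁) = k₁`, `ν_p(H₂) = k₂`, `ν̄_p = r`), `exp_g₂Log`, and `norm_g₂Log_le` —
  `|E_p| ≤ 6k² X²`, `X = p^{−(1−δ₁−δ₂)}`, `k = k₁ + k₂`, when `2kX ≤ 1/2` (the first-order terms
  `−k₁x − k₂y + rz − rz + k₁x + k₂y` cancel);
* `hasProd_G₂Factor_of_mem`, `G₂_eq_prod_mul_exp`, `differentiableOn_G₂` — **(7.10)**: on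
  `Ω = {Re s₁, Re s₂ > −1/4}` the product converges, `G = ∏_{p ≤ B} G₂Factor_p · exp(∑_{p>B} E_p)`
  with `B = max(max H, 16k²)`, and `G` is JOINTLY holomorphic on `Ω ⊆ ℂ × ℂ` (several-variable
  Weierstrass `M`-test of `Literature.Analysis.Complex.LocallyUniformLimitSCV`);
* `norm_G₂_le` — **(7.12)** with explicit constants: for `−1/8 ≤ σ₁, σ₂`, `δ = δ₁ + δ₂`,
  `k' = 2(k₁+k₂)`, `U' = gpyU k' h`, `H₁, H₂ ⊆ [0,h]` nonempty:
  `|G(s₁,s₂)| ≤ exp(k' U'^{δ} (4 log log U' + 25))` (pieces: `|G₂Factor_p| ≤ e^{4k'X}` always,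
  `≤ e^{2k'²X²}` for `p > U'`, `p ∤ Δ(H)`; the three prime sums of the one-variable file).

## References

* D. A. Goldston, J. Pintz, C. Y. Yıldırım, *Primes in tuples. I*, Ann. of Math. (2) 170 (2009),
  819–862 = arXiv:math/0508185, §7, (7.9)–(7.12), p. 15; §6 (6.13)–(6.16).
  [cite: GoldstonPintzYildirim2009]
-/

noncomputable section

open Finset Complex Filter Topology
open scoped ArithmeticFunction.Moebius ArithmeticFunction.omega

namespace Literature.NumberTheory.Sieve.GPY

/-! ### The Euler factors of `G` ((7.10)) and `G(0,0) = 𝔖(H)` ((7.11)) -/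

/-- GPY (7.10): the Euler factor of `G(s₁,s₂)`,
`F₂Factor_p(s₁,s₂) · (1 − p^{−(1+s₁+s₂)})^r · (1 − p^{−(1+s₁)})^{−k₁} · (1 − p^{−(1+s₂)})^{−k₂}`,
`r = |H₁ ∩ H₂|`, `kᵢ = |Hᵢ|`. [cite: GoldstonPintzYildirim2009, Section 7 eq. 7.10] -/
def G₂Factor (H₁ H₂ : Finset ℕ) (p : ℕ) (s₁ s₂ : ℂ) : ℂ :=
  F₂Factor H₁ H₂ p s₁ s₂ * (1 - (p : ℂ) ^ (-(1 + s₁ + s₂))) ^ #(H₁ ∩ H₂) *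
    ((1 - (p : ℂ) ^ (-(1 + s₁)))⁻¹) ^ #H₁ * ((1 - (p : ℂ) ^ (-(1 + s₂)))⁻¹) ^ #H₂

/-- GPY (7.10): `G(s₁,s₂) = ∏_p G₂Factor_p(s₁,s₂)` (unconditional product over the primes; it
converges absolutely for `Re s₁, Re s₂ > −1/4`, `hasProd_G₂Factor_of_mem`).
[cite: GoldstonPintzYildirim2009, Section 7 eq. 7.10] -/
def G₂ (H₁ H₂ : Finset ℕ) (s₁ s₂ : ℂ) : ℂ := ∏' p : Nat.Primes, G₂Factor H₁ H₂ p s₁ s₂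

/-- `ν̄_p = ν_p(H₁) + ν_p(H₂) − ν_p(H₁ ∪ H₂)` in `ℂ` (no truncation: `ν_p(H₁ ∪ H₂) ≤ ν_p(H₁) + ν_p(H₂)`).
[cite: GoldstonPintzYildirim2009, Section 7 eq. 7.5] -/
theorem nuBar_cast (H₁ H₂ : Finset ℕ) (p : ℕ) :
    (nuBar H₁ H₂ p : ℂ) = nuPrime H₁ p + nuPrime H₂ p - nuPrime (H₁ ∪ H₂) p := by
  rw [nuBar, Nat.cast_sub (nuPrime_union_le H₁ H₂ p)]
  push_cast
  ring

/-- At `(0,0)` the two-variable factor is the Hardy–Littlewood factor of `H = H₁ ∪ H₂`: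
`G₂Factor_p(0,0) = (1 − ν_p(H)/p)(1 − 1/p)^{−|H|} = GFactor H p 0` (`ν₁ + ν₂ − ν̄ = ν(H)`,
`k₁ + k₂ − r = |H|`). [cite: GoldstonPintzYildirim2009, Section 7 eq. 7.11] -/
theorem G₂Factor_zero_zero (H₁ H₂ : Finset ℕ) {p : ℕ} (hp : p.Prime) :
    G₂Factor H₁ H₂ p 0 0 = GFactor (H₁ ∪ H₂) p 0 := by
  have hp0 : (p : ℂ) ≠ 0 := by exact_mod_cast hp.ne_zero
  have hw : (1 : ℂ) - (p : ℂ) ^ (-(1 : ℂ)) ≠ 0 := by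
    apply one_sub_ne_zero_of_norm_le_half
    rw [Complex.cpow_neg_one, norm_inv, Complex.norm_natCast]
    have h2 : (2 : ℝ) ≤ p := by exact_mod_cast hp.two_le
    exact (inv_anti₀ two_pos h2).trans_eq (by norm_num)
  have hcard : #H₁ + #H₂ = #(H₁ ∪ H₂) + #(H₁ ∩ H₂) := (Finset.card_union_add_card_inter H₁ H₂).symm
  unfold G₂Factor GFactor F₂Factor FFactor
  simp only [add_zero]
  rw [nuBar_cast]
  -- collect the powers of `(1 - p⁻¹)⁻¹`
  have hpow : (1 - (p : ℂ) ^ (-(1 : ℂ))) ^ #(H₁ ∩ H₂) * ((1 - (p : ℂ) ^ (-(1 : ℂ)))⁻¹) ^ #H₁ *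
      ((1 - (p : ℂ) ^ (-(1 : ℂ)))⁻¹) ^ #H₂ = ((1 - (p : ℂ) ^ (-(1 : ℂ)))⁻¹) ^ #(H₁ ∪ H₂) := by
    set v : ℂ := (1 - (p : ℂ) ^ (-(1 : ℂ)))⁻¹ with hvdef
    have hv : (1 - (p : ℂ) ^ (-(1 : ℂ))) * v = 1 := mul_inv_cancel₀ hw
    calc (1 - (p : ℂ) ^ (-(1 : ℂ))) ^ #(H₁ ∩ H₂) * v ^ #H₁ * v ^ #H₂
        = (1 - (p : ℂ) ^ (-(1 : ℂ))) ^ #(H₁ ∩ H₂) * v ^ (#H₁ + #H₂) := by rw [mul_assoc, ← pow_add]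
      _ = (1 - (p : ℂ) ^ (-(1 : ℂ))) ^ #(H₁ ∩ H₂) * v ^ (#(H₁ ∪ H₂) + #(H₁ ∩ H₂)) := by rw [hcard]
      _ = ((1 - (p : ℂ) ^ (-(1 : ℂ))) * v) ^ #(H₁ ∩ H₂) * v ^ #(H₁ ∪ H₂) := by rw [pow_add, mul_pow]; ring
      _ = v ^ #(H₁ ∪ H₂) := by rw [hv, one_pow, one_mul]
  calc (1 - (nuPrime H₁ p : ℂ) / (p : ℂ) ^ (1 : ℂ) - (nuPrime H₂ p : ℂ) / (p : ℂ) ^ (1 : ℂ) +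
        ((nuPrime H₁ p : ℂ) + nuPrime H₂ p - nuPrime (H₁ ∪ H₂) p) / (p : ℂ) ^ (1 : ℂ)) *
        (1 - (p : ℂ) ^ (-(1 : ℂ))) ^ #(H₁ ∩ H₂) * ((1 - (p : ℂ) ^ (-(1 : ℂ)))⁻¹) ^ #H₁ *
        ((1 - (p : ℂ) ^ (-(1 : ℂ)))⁻¹) ^ #H₂
      = (1 - (nuPrime (H₁ ∪ H₂) p : ℂ) / (p : ℂ) ^ (1 : ℂ)) *
        ((1 - (p : ℂ) ^ (-(1 : ℂ))) ^ #(H₁ ∩ H₂) * ((1 - (p : ℂ) ^ (-(1 : ℂ)))⁻¹) ^ #H₁ *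
        ((1 - (p : ℂ) ^ (-(1 : ℂ)))⁻¹) ^ #H₂) := by ring
    _ = (1 - (nuPrime (H₁ ∪ H₂) p : ℂ) / (p : ℂ) ^ (1 : ℂ)) *
        ((1 - (p : ℂ) ^ (-(1 : ℂ)))⁻¹) ^ #(H₁ ∪ H₂) := by rw [hpow]

/-- **GPY (7.11)**: `G(0,0) = 𝔖(H)`, `H = H₁ ∪ H₂`. [cite: GoldstonPintzYildirim2009, Section 7 eq. 7.11] -/
theorem G₂_zero_zero (H₁ H₂ : Finset ℕ) : G₂ H₁ H₂ 0 0 = (singularSeriesNat (H₁ ∪ H₂) : ℂ) := by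
  rw [G₂, ← GH_zero, GH]
  exact tprod_congr fun p => G₂Factor_zero_zero H₁ H₂ p.2

/-! ### (7.9): `F = G ζ(1+s₁+s₂)^r ζ(1+s₁)^{−k₁} ζ(1+s₂)^{−k₂}` -/

/-- Inverting an infinite product in `ℂ` with nonzero value. [folklore] -/
theorem hasProd_inv₀ {ι : Type*} {f : ι → ℂ} {a : ℂ} (h : HasProd f a) (ha : a ≠ 0) :
    HasProd (fun i => (f i)⁻¹) a⁻¹ := by
  unfold HasProd at h ⊢
  have heq : (fun s : Finset ι => ∏ b ∈ s, (f b)⁻¹) = fun s => (∏ b ∈ s, f b)⁻¹ :=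
    funext fun s => Finset.prod_inv_distrib _
  rw [heq]
  exact h.inv₀ ha

/-- The Euler product of `ζ(w)⁻¹`: `HasProd (p ↦ 1 − p^{−w}) (ζ(w)⁻¹)` for `Re w > 1`. [folklore] -/
theorem hasProd_one_sub_inv_riemannZeta {w : ℂ} (hw : 1 < w.re) :
    HasProd (fun p : Nat.Primes => 1 - (p : ℂ) ^ (-w)) (riemannZeta w)⁻¹ := by
  have h := hasProd_inv₀ (riemannZeta_eulerProduct_hasProd hw) (riemannZeta_ne_zero_of_one_lt_re hw)
  simpa only [inv_inv] using h

/-- **GPY (7.9), product form**: for `Re s₁, Re s₂ ≥ 1` (and `k₁ + k₂ ≥ 1`),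
`HasProd G₂Factor (F(s₁,s₂) · ζ(1+s₁+s₂)^{−r} · ζ(1+s₁)^{k₁} · ζ(1+s₂)^{k₂})`.
[cite: GoldstonPintzYildirim2009, Section 7 eq. 7.9] -/
theorem hasProd_G₂Factor (H₁ H₂ : Finset ℕ) (hk : 1 ≤ #H₁ + #H₂) {s₁ s₂ : ℂ}
    (hs₁ : 1 ≤ s₁.re) (hs₂ : 1 ≤ s₂.re) :
    HasProd (fun p : Nat.Primes => G₂Factor H₁ H₂ p s₁ s₂)
      (FDir₂ H₁ H₂ s₁ s₂ * (riemannZeta (1 + s₁ + s₂))⁻¹ ^ #(H₁ ∩ H₂) *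
        riemannZeta (1 + s₁) ^ #H₁ * riemannZeta (1 + s₂) ^ #H₂) := by
  have hF := hasProd_F₂Factor H₁ H₂ hk hs₁ hs₂
  have h12 : 1 < (1 + s₁ + s₂).re := by simp only [add_re, one_re]; linarith
  have h1 : 1 < (1 + s₁).re := by simp only [add_re, one_re]; linarith
  have h2 : 1 < (1 + s₂).re := by simp only [add_re, one_re]; linarith
  have hZ := hasProd_one_sub_inv_riemannZeta h12
  have hζ1 := riemannZeta_eulerProduct_hasProd h1
  have hζ2 := riemannZeta_eulerProduct_hasProd h2
  exact ((hF.mul (hZ.pow #(H₁ ∩ H₂))).mul (hζ1.pow #H₁)).mul (hζ2.pow #H₂)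

/-- **GPY (7.9)**: `F(s₁,s₂) = G(s₁,s₂) ζ(1+s₁+s₂)^r / (ζ(1+s₁)^{k₁} ζ(1+s₂)^{k₂})` for
`Re s₁, Re s₂ ≥ 1`. [cite: GoldstonPintzYildirim2009, Section 7 eq. 7.9] -/
theorem FDir₂_eq_G₂_mul (H₁ H₂ : Finset ℕ) (hk : 1 ≤ #H₁ + #H₂) {s₁ s₂ : ℂ}
    (hs₁ : 1 ≤ s₁.re) (hs₂ : 1 ≤ s₂.re) :
    FDir₂ H₁ H₂ s₁ s₂ = G₂ H₁ H₂ s₁ s₂ * riemannZeta (1 + s₁ + s₂) ^ #(H₁ ∩ H₂) /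
      (riemannZeta (1 + s₁) ^ #H₁ * riemannZeta (1 + s₂) ^ #H₂) := by
  have h12 : 1 < (1 + s₁ + s₂).re := by simp only [add_re, one_re]; linarith
  have h1 : 1 < (1 + s₁).re := by simp only [add_re, one_re]; linarith
  have h2 : 1 < (1 + s₂).re := by simp only [add_re, one_re]; linarith
  have hz12 := riemannZeta_ne_zero_of_one_lt_re h12
  have hz1 := riemannZeta_ne_zero_of_one_lt_re h1
  have hz2 := riemannZeta_ne_zero_of_one_lt_re h2
  rw [G₂, (hasProd_G₂Factor H₁ H₂ hk hs₁ hs₂).tprod_eq,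
    eq_div_iff (mul_ne_zero (pow_ne_zero _ hz1) (pow_ne_zero _ hz2))]
  have hζ12r : (riemannZeta (1 + s₁ + s₂))⁻¹ ^ #(H₁ ∩ H₂) * riemannZeta (1 + s₁ + s₂) ^ #(H₁ ∩ H₂) =
      1 := by rw [← mul_pow, inv_mul_cancel₀ hz12, one_pow]
  calc FDir₂ H₁ H₂ s₁ s₂ * (riemannZeta (1 + s₁) ^ #H₁ * riemannZeta (1 + s₂) ^ #H₂)
      = FDir₂ H₁ H₂ s₁ s₂ * ((riemannZeta (1 + s₁ + s₂))⁻¹ ^ #(H₁ ∩ H₂) *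
          riemannZeta (1 + s₁ + s₂) ^ #(H₁ ∩ H₂)) *
          (riemannZeta (1 + s₁) ^ #H₁ * riemannZeta (1 + s₂) ^ #H₂) := by rw [hζ12r, mul_one]
    _ = _ := by ring

/-! ### The generic tail factors: `E_p = log` of the factor, and `|E_p| ≤ 6k²X²` -/

/-- `ν_p(H₁) = k₁`, `ν_p(H₂) = k₂`, `ν̄_p = r` — the "generic" values taken for `p > h` (and for
`p ∤ Δ(H)`). [cite: GoldstonPintzYildirim2009, Section 7 eq. 7.9] -/
def IsGeneric (H₁ H₂ : Finset ℕ) (p : ℕ) : Prop :=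
  nuPrime H₁ p = #H₁ ∧ nuPrime H₂ p = #H₂ ∧ nuBar H₁ H₂ p = #(H₁ ∩ H₂)

/-- If the elements of `H₁ ∪ H₂` are distinct modulo `p` (`ν_p(H₁ ∪ H₂) = |H₁ ∪ H₂|`) then `p` is
generic. [cite: GoldstonPintzYildirim2009, Section 7 eq. 7.9] -/
theorem isGeneric_of_nuPrime_union {H₁ H₂ : Finset ℕ} {p : ℕ} (h : nuPrime (H₁ ∪ H₂) p = #(H₁ ∪ H₂)) :
    IsGeneric H₁ H₂ p := by
  -- `x ↦ x % p` is injective on `H₁ ∪ H₂`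
  have hinj : Set.InjOn (fun x => x % p) ↑(H₁ ∪ H₂) := Finset.card_image_iff.1 h
  have h1 : nuPrime H₁ p = #H₁ :=
    Finset.card_image_of_injOn (hinj.mono (by simp))
  have h2 : nuPrime H₂ p = #H₂ :=
    Finset.card_image_of_injOn (hinj.mono (by simp))
  refine ⟨h1, h2, ?_⟩
  unfold nuBar
  rw [h1, h2, h]
  have := Finset.card_union_add_card_inter H₁ H₂
  omega

/-- Primes above `max(H₁ ∪ H₂)` are generic. [cite: GoldstonPintzYildirim2009, Section 7 eq. 7.9] -/
theorem isGeneric_of_lt {H₁ H₂ : Finset ℕ} {p : ℕ} (hp : ∀ x ∈ H₁ ∪ H₂, x < p) : IsGeneric H₁ H₂ p :=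
  isGeneric_of_nuPrime_union (nuPrime_eq_card hp)

/-- `Δ(H') ∣ Δ(H)` for `H' ⊆ H`. [cite: GoldstonPintzYildirim2009, Section 6 eq. 6.13] -/
theorem discr_dvd_discr_of_subset {H' H : Finset ℕ} (h : H' ⊆ H) : discr H' ∣ discr H := by
  unfold discr
  refine dvd_trans ?_ (Finset.prod_dvd_prod_of_subset H' H _ h)
  exact Finset.prod_dvd_prod_of_dvd _ _ fun a _ =>
    Finset.prod_dvd_prod_of_subset _ _ _ (Finset.filter_subset_filter _ h)

/-- Primes not dividing `Δ(H₁ ∪ H₂)` are generic ("`ν_p(H) = k` whenever `p ∤ Δ`").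
[cite: GoldstonPintzYildirim2009, Section 6 eq. 6.13] -/
theorem isGeneric_of_not_dvd_discr {H₁ H₂ : Finset ℕ} {p : ℕ} (hΔ : ¬ p ∣ discr (H₁ ∪ H₂)) :
    IsGeneric H₁ H₂ p :=
  isGeneric_of_nuPrime_union (nuPrime_eq_card_of_not_dvd hΔ)

/-- The logarithm of the generic factor of `G` ((7.10) for `ν_p(H₁) = k₁`, `ν_p(H₂) = k₂`,
`ν̄_p = r`): with `x = p^{−(1+s₁)}`, `y = p^{−(1+s₂)}`, `z = p^{−(1+s₁+s₂)}`,
`E_p = log(1 − k₁x − k₂y + rz) + r log(1 − z) − k₁ log(1 − x) − k₂ log(1 − y)`.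
[cite: GoldstonPintzYildirim2009, Section 7 eq. 7.10] -/
def g₂Log (k₁ k₂ r p : ℕ) (s₁ s₂ : ℂ) : ℂ :=
  Complex.log (1 - k₁ * (p : ℂ) ^ (-(1 + s₁)) - k₂ * (p : ℂ) ^ (-(1 + s₂)) +
      r * (p : ℂ) ^ (-(1 + s₁ + s₂))) +
    r * Complex.log (1 - (p : ℂ) ^ (-(1 + s₁ + s₂))) -
    k₁ * Complex.log (1 - (p : ℂ) ^ (-(1 + s₁))) - k₂ * Complex.log (1 - (p : ℂ) ^ (-(1 + s₂)))

/-- `‖log(1 + u) − u‖ ≤ ‖u‖²` for `‖u‖ ≤ 1/2` (the tree's `norm_neg_log_one_sub_sub_le` at `−u`).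
[folklore] -/
theorem norm_log_one_add_sub_le {u : ℂ} (hu : ‖u‖ ≤ 1 / 2) : ‖Complex.log (1 + u) - u‖ ≤ ‖u‖ ^ 2 := by
  have h := Literature.NumberTheory.LFunctions.norm_neg_log_one_sub_sub_le (z := -u) (by rwa [norm_neg])
  simp only [norm_neg, sub_neg_eq_add] at h
  calc ‖Complex.log (1 + u) - u‖ = ‖-(Complex.log (1 + u) - u)‖ := (norm_neg _).symm
    _ = ‖-Complex.log (1 + u) + u‖ := by congr 1; ring
    _ ≤ ‖u‖ ^ 2 := h

/-- The generic factor is `exp(E_p)` as soon as `‖k₁x + k₂y − rz‖, ‖x‖, ‖y‖, ‖z‖ ≤ 1/2` (all the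
`1 − (⋯)` lie in the right half-plane). [cite: GoldstonPintzYildirim2009, Section 7 eq. 7.10] -/
theorem exp_g₂Log {k₁ k₂ r p : ℕ} {s₁ s₂ : ℂ}
    (hw : ‖(k₁ : ℂ) * (p : ℂ) ^ (-(1 + s₁)) + k₂ * (p : ℂ) ^ (-(1 + s₂)) -
      r * (p : ℂ) ^ (-(1 + s₁ + s₂))‖ ≤ 1 / 2)
    (hx : ‖(p : ℂ) ^ (-(1 + s₁))‖ ≤ 1 / 2) (hy : ‖(p : ℂ) ^ (-(1 + s₂))‖ ≤ 1 / 2)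
    (hz : ‖(p : ℂ) ^ (-(1 + s₁ + s₂))‖ ≤ 1 / 2) :
    Complex.exp (g₂Log k₁ k₂ r p s₁ s₂) =
      (1 - k₁ * (p : ℂ) ^ (-(1 + s₁)) - k₂ * (p : ℂ) ^ (-(1 + s₂)) + r * (p : ℂ) ^ (-(1 + s₁ + s₂))) *
        (1 - (p : ℂ) ^ (-(1 + s₁ + s₂))) ^ r * ((1 - (p : ℂ) ^ (-(1 + s₁)))⁻¹) ^ k₁ *
          ((1 - (p : ℂ) ^ (-(1 + s₂)))⁻¹) ^ k₂ := by
  set x := (p : ℂ) ^ (-(1 + s₁)) with hxdef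
  set y := (p : ℂ) ^ (-(1 + s₂)) with hydef
  set z := (p : ℂ) ^ (-(1 + s₁ + s₂)) with hzdef
  have hw' : (1 : ℂ) - k₁ * x - k₂ * y + r * z = 1 - (k₁ * x + k₂ * y - r * z) := by ring
  rw [g₂Log, ← hxdef, ← hydef, ← hzdef, hw']
  rw [Complex.exp_sub, Complex.exp_sub, Complex.exp_add, Complex.exp_log (one_sub_ne_zero_of_norm_le_half hw),
    Complex.exp_nat_mul, Complex.exp_nat_mul, Complex.exp_nat_mul,
    Complex.exp_log (one_sub_ne_zero_of_norm_le_half hz),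
    Complex.exp_log (one_sub_ne_zero_of_norm_le_half hx),
    Complex.exp_log (one_sub_ne_zero_of_norm_le_half hy)]
  rw [inv_pow, inv_pow, div_eq_mul_inv, div_eq_mul_inv]

/-- **`|E_p| ≤ 6k²X²`**: if `‖x‖, ‖y‖, ‖z‖ ≤ X`, `r ≤ k₁`, `k = k₁ + k₂ ≥ 1` and `2kX ≤ 1/2`, then
`‖E_p‖ ≤ 6 k² X²`. The first-order terms cancel:
`E_p = L(w) + r L(−z) − k₁ L(−x) − k₂ L(−y)`, `L(u) = log(1+u) − u`, `w = −k₁x − k₂y + rz`,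
`‖L(u)‖ ≤ ‖u‖²`. [cite: GoldstonPintzYildirim2009, Section 7 eq. 7.10] -/
theorem norm_g₂Log_le {k₁ k₂ r p : ℕ} {s₁ s₂ : ℂ} {X : ℝ} (hr : r ≤ k₁) (hk : 1 ≤ k₁ + k₂)
    (hx : ‖(p : ℂ) ^ (-(1 + s₁))‖ ≤ X) (hy : ‖(p : ℂ) ^ (-(1 + s₂))‖ ≤ X)
    (hz : ‖(p : ℂ) ^ (-(1 + s₁ + s₂))‖ ≤ X) (hX : 2 * ((k₁ + k₂ : ℕ) : ℝ) * X ≤ 1 / 2) :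
    ‖g₂Log k₁ k₂ r p s₁ s₂‖ ≤ 6 * ((k₁ + k₂ : ℕ) : ℝ) ^ 2 * X ^ 2 := by
  set x := (p : ℂ) ^ (-(1 + s₁)) with hxdef
  set y := (p : ℂ) ^ (-(1 + s₂)) with hydef
  set z := (p : ℂ) ^ (-(1 + s₁ + s₂)) with hzdef
  set k : ℕ := k₁ + k₂ with hkdef
  have hk1 : (1 : ℝ) ≤ k := by exact_mod_cast hk
  have hX0 : 0 ≤ X := (norm_nonneg _).trans hx
  have hkX : X ≤ 2 * (k : ℝ) * X := by nlinarith
  have hX2 : X ≤ 1 / 2 := hkX.trans hX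
  have hr' : (r : ℝ) ≤ k := by
    have : r ≤ k₁ + k₂ := hr.trans (Nat.le_add_right _ _)
    exact_mod_cast this
  have hk₁ : (k₁ : ℝ) ≤ k := by exact_mod_cast Nat.le_add_right k₁ k₂
  have hk₂ : (k₂ : ℝ) ≤ k := by exact_mod_cast Nat.le_add_left k₂ k₁
  set w : ℂ := -(k₁ * x) - k₂ * y + r * z with hwdef
  -- `‖w‖ ≤ k₁‖x‖ + k₂‖y‖ + r‖z‖ ≤ 2kX ≤ 1/2`
  have hwsum : ‖w‖ ≤ k₁ * ‖x‖ + k₂ * ‖y‖ + r * ‖z‖ := by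
    calc ‖w‖ ≤ ‖-(k₁ * x) - k₂ * y‖ + ‖(r : ℂ) * z‖ := norm_add_le _ _
      _ ≤ ‖-((k₁ : ℂ) * x)‖ + ‖(k₂ : ℂ) * y‖ + ‖(r : ℂ) * z‖ := by
          gcongr; exact norm_sub_le _ _
      _ = k₁ * ‖x‖ + k₂ * ‖y‖ + r * ‖z‖ := by
          rw [norm_neg, norm_mul, norm_mul, norm_mul, Complex.norm_natCast, Complex.norm_natCast,
            Complex.norm_natCast]
  have hw : ‖w‖ ≤ 2 * (k : ℝ) * X := by
    have h2 : (k₁ : ℝ) * ‖x‖ + k₂ * ‖y‖ + r * ‖z‖ ≤ k₁ * X + k₂ * X + k₁ * X := by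
      have hrr : (r : ℝ) ≤ k₁ := by exact_mod_cast hr
      gcongr
    have h3 : (k₁ : ℝ) * X + k₂ * X + k₁ * X ≤ 2 * (k : ℝ) * X := by
      have : ((k₁ + k₂ : ℕ) : ℝ) = k₁ + k₂ := by push_cast; ring
      rw [hkdef, this]; nlinarith
    exact hwsum.trans (h2.trans h3)
  have hw2 : ‖w‖ ≤ 1 / 2 := hw.trans hX
  -- the decomposition into second-order terms
  have hdecomp : g₂Log k₁ k₂ r p s₁ s₂ =
      (Complex.log (1 + w) - w) + r * (Complex.log (1 + -z) - -z) -
        k₁ * (Complex.log (1 + -x) - -x) - k₂ * (Complex.log (1 + -y) - -y) := by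
    rw [g₂Log, ← hxdef, ← hydef, ← hzdef]
    have e1 : (1 : ℂ) - k₁ * x - k₂ * y + r * z = 1 + w := by rw [hwdef]; ring
    rw [e1, ← sub_eq_add_neg, ← sub_eq_add_neg, ← sub_eq_add_neg]
    rw [hwdef]; ring
  have hLw := norm_log_one_add_sub_le hw2
  have hLz := norm_log_one_add_sub_le (u := -z) (by rw [norm_neg]; exact hz.trans hX2)
  have hLx := norm_log_one_add_sub_le (u := -x) (by rw [norm_neg]; exact hx.trans hX2)
  have hLy := norm_log_one_add_sub_le (u := -y) (by rw [norm_neg]; exact hy.trans hX2)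
  rw [norm_neg] at hLz hLx hLy
  rw [hdecomp]
  have hxX : ‖x‖ ^ 2 ≤ X ^ 2 := pow_le_pow_left₀ (norm_nonneg _) hx 2
  have hyX : ‖y‖ ^ 2 ≤ X ^ 2 := pow_le_pow_left₀ (norm_nonneg _) hy 2
  have hzX : ‖z‖ ^ 2 ≤ X ^ 2 := pow_le_pow_left₀ (norm_nonneg _) hz 2
  have hwX : ‖w‖ ^ 2 ≤ (2 * (k : ℝ) * X) ^ 2 := pow_le_pow_left₀ (norm_nonneg _) hw 2
  calc ‖(Complex.log (1 + w) - w) + r * (Complex.log (1 + -z) - -z) -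
        k₁ * (Complex.log (1 + -x) - -x) - k₂ * (Complex.log (1 + -y) - -y)‖
      ≤ ‖Complex.log (1 + w) - w‖ + ‖(r : ℂ) * (Complex.log (1 + -z) - -z)‖ +
          ‖(k₁ : ℂ) * (Complex.log (1 + -x) - -x)‖ + ‖(k₂ : ℂ) * (Complex.log (1 + -y) - -y)‖ := by
        refine (norm_sub_le _ _).trans ?_
        gcongr
        refine (norm_sub_le _ _).trans ?_
        gcongr
        exact norm_add_le _ _
    _ = ‖Complex.log (1 + w) - w‖ + r * ‖Complex.log (1 + -z) - -z‖ +
          k₁ * ‖Complex.log (1 + -x) - -x‖ + k₂ * ‖Complex.log (1 + -y) - -y‖ := by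
        rw [norm_mul, norm_mul, norm_mul, Complex.norm_natCast, Complex.norm_natCast,
          Complex.norm_natCast]
    _ ≤ (2 * (k : ℝ) * X) ^ 2 + r * X ^ 2 + k₁ * X ^ 2 + k₂ * X ^ 2 := by
        gcongr
        · exact hLw.trans hwX
        · exact hLz.trans hzX
        · exact hLx.trans hxX
        · exact hLy.trans hyX
    _ ≤ (2 * (k : ℝ) * X) ^ 2 + k * X ^ 2 + k * X ^ 2 := by
        have : (k₁ : ℝ) * X ^ 2 + k₂ * X ^ 2 = k * X ^ 2 := by
          rw [hkdef]; push_cast; ring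
        nlinarith [mul_nonneg (sub_nonneg.2 hr') (sq_nonneg X)]
    _ = (4 * (k : ℝ) ^ 2 + 2 * k) * X ^ 2 := by ring
    _ ≤ 6 * (k : ℝ) ^ 2 * X ^ 2 := by
        have : (k : ℝ) ≤ (k : ℝ) ^ 2 := by nlinarith
        nlinarith [sq_nonneg X]

/-! ### Convergence and joint holomorphy of `G` on `Re s₁, Re s₂ > −1/4` ((7.10)) -/

/-- The region `Ω = {(s₁,s₂) : Re s₁ > −1/4, Re s₂ > −1/4} ⊆ ℂ × ℂ` on which the Euler product of
`G` converges absolutely. [cite: GoldstonPintzYildirim2009, Section 7 eq. 7.10] -/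
def G₂Region : Set (ℂ × ℂ) := {z | -1 / 4 < z.1.re ∧ -1 / 4 < z.2.re}

/-- The sub-regions `Ω_η = {Re s₁ > −1/4 + η, Re s₂ > −1/4 + η}` carrying uniform tail bounds.
[cite: GoldstonPintzYildirim2009, Section 7 eq. 7.10] -/
def G₂RegionSub (η : ℝ) : Set (ℂ × ℂ) := {z | -1 / 4 + η < z.1.re ∧ -1 / 4 + η < z.2.re}

/-- `Ω` is open. [folklore] -/
theorem isOpen_G₂Region : IsOpen G₂Region :=
  (isOpen_lt continuous_const (Complex.continuous_re.comp continuous_fst)).inter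
    (isOpen_lt continuous_const (Complex.continuous_re.comp continuous_snd))

/-- `Ω_η` is open. [folklore] -/
theorem isOpen_G₂RegionSub (η : ℝ) : IsOpen (G₂RegionSub η) :=
  (isOpen_lt continuous_const (Complex.continuous_re.comp continuous_fst)).inter
    (isOpen_lt continuous_const (Complex.continuous_re.comp continuous_snd))

/-- The threshold `B = max(max(H₁ ∪ H₂), 16k²)`, `k = k₁ + k₂`, beyond which the factors of `G` are
generic and `exp(E_p)` with `|E_p| ≤ 6k²X²`. [cite: GoldstonPintzYildirim2009, Section 7 eq. 7.10] -/
def tailBound₂ (H₁ H₂ : Finset ℕ) : ℕ := max ((H₁ ∪ H₂).sup id) (16 * (#H₁ + #H₂) ^ 2)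

/-- Primes above `B` exceed every element of `H₁ ∪ H₂`. [folklore] -/
theorem lt_of_tailBound₂_lt {H₁ H₂ : Finset ℕ} {p : ℕ} (hp : tailBound₂ H₁ H₂ < p) :
    ∀ x ∈ H₁ ∪ H₂, x < p :=
  fun _ hx => lt_of_le_of_lt (Finset.le_sup (f := id) hx) ((le_max_left _ _).trans_lt hp)

/-- `16k² < p` once `p > B`. [folklore] -/
theorem sixteen_mul_sq_lt_of_tailBound₂_lt {H₁ H₂ : Finset ℕ} {p : ℕ} (hp : tailBound₂ H₁ H₂ < p) :
    16 * (#H₁ + #H₂) ^ 2 < p :=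
  (le_max_right _ _).trans_lt hp

/-- `|p^{−(1+s₁+s₂)}| = p^{−(1+σ₁+σ₂)}`. [folklore] -/
theorem norm_natCast_cpow_neg_add {p : ℕ} (hp : 0 < p) (s₁ s₂ : ℂ) :
    ‖(p : ℂ) ^ (-(1 + s₁ + s₂))‖ = (p : ℝ) ^ (-(1 + s₁.re + s₂.re)) := by
  rw [Complex.norm_natCast_cpow_of_pos hp]; simp

/-- For `p > 16k²` (`k ≥ 1`): `2k p^{−1/2} ≤ 1/2`. [folklore] -/
theorem two_mul_card_mul_rpow_le_half {k p : ℕ} (hk : 1 ≤ k) (hp : 16 * k ^ 2 < p) :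
    2 * (k : ℝ) * (p : ℝ) ^ (-(1 / 2 : ℝ)) ≤ 1 / 2 := by
  have hp0 : (0 : ℝ) < p := by exact_mod_cast (show 0 < p by nlinarith)
  have h16 : ((16 * k ^ 2 : ℕ) : ℝ) ≤ p := by exact_mod_cast hp.le
  push_cast at h16
  have hsqrt : 4 * (k : ℝ) ≤ Real.sqrt p := by
    rw [Real.le_sqrt (by positivity) hp0.le]; nlinarith
  have hsq0 : 0 < Real.sqrt p := Real.sqrt_pos.2 hp0
  rw [Real.rpow_neg hp0.le, ← Real.sqrt_eq_rpow]
  rw [show 2 * (k : ℝ) * (Real.sqrt p)⁻¹ = 2 * k / Real.sqrt p by ring, div_le_iff₀ hsq0]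
  linarith

/-- On `Ω_η` (`0 ≤ η ≤ 1/4`), for `p > 16k²`: with `X = p^{−(1/2+2η)}` one has `‖x‖, ‖y‖, ‖z‖ ≤ X`
and `2kX ≤ 1/2`. [cite: GoldstonPintzYildirim2009, Section 7 eq. 7.10] -/
theorem norms_le_of_mem_sub {H₁ H₂ : Finset ℕ} (hk : 1 ≤ #H₁ + #H₂) {η : ℝ} (hη0 : 0 ≤ η)
    (hη : η ≤ 1 / 4) {z : ℂ × ℂ} (hz : z ∈ G₂RegionSub η) {p : ℕ}
    (hp : 16 * (#H₁ + #H₂) ^ 2 < p) :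
    ‖(p : ℂ) ^ (-(1 + z.1))‖ ≤ (p : ℝ) ^ (-(1 / 2 + 2 * η)) ∧
    ‖(p : ℂ) ^ (-(1 + z.2))‖ ≤ (p : ℝ) ^ (-(1 / 2 + 2 * η)) ∧
    ‖(p : ℂ) ^ (-(1 + z.1 + z.2))‖ ≤ (p : ℝ) ^ (-(1 / 2 + 2 * η)) ∧
    2 * ((#H₁ + #H₂ : ℕ) : ℝ) * (p : ℝ) ^ (-(1 / 2 + 2 * η)) ≤ 1 / 2 := by
  obtain ⟨h1, h2⟩ := hz
  have hp0 : 0 < p := by nlinarith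
  have hp1 : (1 : ℝ) ≤ p := by exact_mod_cast hp0
  refine ⟨?_, ?_, ?_, ?_⟩
  · rw [norm_natCast_cpow_neg hp0]
    exact Real.rpow_le_rpow_of_exponent_le hp1 (by linarith)
  · rw [norm_natCast_cpow_neg hp0]
    exact Real.rpow_le_rpow_of_exponent_le hp1 (by linarith)
  · rw [norm_natCast_cpow_neg_add hp0]
    exact Real.rpow_le_rpow_of_exponent_le hp1 (by linarith)
  · calc 2 * ((#H₁ + #H₂ : ℕ) : ℝ) * (p : ℝ) ^ (-(1 / 2 + 2 * η))
        ≤ 2 * ((#H₁ + #H₂ : ℕ) : ℝ) * (p : ℝ) ^ (-(1 / 2 : ℝ)) := by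
          refine mul_le_mul_of_nonneg_left ?_ (by positivity)
          exact Real.rpow_le_rpow_of_exponent_le hp1 (by linarith)
      _ ≤ 1 / 2 := two_mul_card_mul_rpow_le_half hk hp

/-- For a generic prime the factor of `G` is `exp(E_p)` (when `‖k₁x + k₂y − rz‖, ‖x‖, ‖y‖, ‖z‖ ≤ 1/2`).
[cite: GoldstonPintzYildirim2009, Section 7 eq. 7.10] -/
theorem G₂Factor_eq_exp_of_isGeneric {H₁ H₂ : Finset ℕ} {p : ℕ} (hg : IsGeneric H₁ H₂ p)
    {s₁ s₂ : ℂ}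
    (hw : ‖(#H₁ : ℂ) * (p : ℂ) ^ (-(1 + s₁)) + #H₂ * (p : ℂ) ^ (-(1 + s₂)) -
      #(H₁ ∩ H₂) * (p : ℂ) ^ (-(1 + s₁ + s₂))‖ ≤ 1 / 2)
    (hx : ‖(p : ℂ) ^ (-(1 + s₁))‖ ≤ 1 / 2) (hy : ‖(p : ℂ) ^ (-(1 + s₂))‖ ≤ 1 / 2)
    (hz : ‖(p : ℂ) ^ (-(1 + s₁ + s₂))‖ ≤ 1 / 2) :
    G₂Factor H₁ H₂ p s₁ s₂ = Complex.exp (g₂Log #H₁ #H₂ #(H₁ ∩ H₂) p s₁ s₂) := by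
  obtain ⟨hν1, hν2, hν12⟩ := hg
  rw [exp_g₂Log hw hx hy hz, G₂Factor, F₂Factor, hν1, hν2, hν12]
  congr 1
  rw [Complex.cpow_neg _ (1 + s₁), Complex.cpow_neg _ (1 + s₂), Complex.cpow_neg _ (1 + s₁ + s₂)]
  simp only [div_eq_mul_inv]

/-- For `p > B` and `(s₁,s₂) ∈ Ω`: the factor is `exp(E_p)`.
[cite: GoldstonPintzYildirim2009, Section 7 eq. 7.10] -/
theorem G₂Factor_eq_exp_g₂Log {H₁ H₂ : Finset ℕ} (hk : 1 ≤ #H₁ + #H₂) {p : ℕ}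
    (hpB : tailBound₂ H₁ H₂ < p) {z : ℂ × ℂ} (hz : z ∈ G₂Region) :
    G₂Factor H₁ H₂ p z.1 z.2 = Complex.exp (g₂Log #H₁ #H₂ #(H₁ ∩ H₂) p z.1 z.2) := by
  have hz' : z ∈ G₂RegionSub 0 := by simpa [G₂RegionSub, G₂Region] using hz
  obtain ⟨hx, hy, hzz, hX⟩ := norms_le_of_mem_sub hk le_rfl (by norm_num) hz'
    (sixteen_mul_sq_lt_of_tailBound₂_lt hpB)
  set X : ℝ := (p : ℝ) ^ (-(1 / 2 + 2 * (0 : ℝ))) with hXdef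
  have hk1 : (1 : ℝ) ≤ ((#H₁ + #H₂ : ℕ) : ℝ) := by exact_mod_cast hk
  have hX0 : 0 ≤ X := (norm_nonneg _).trans hx
  have hX2 : X ≤ 1 / 2 := by nlinarith
  refine G₂Factor_eq_exp_of_isGeneric (isGeneric_of_lt (lt_of_tailBound₂_lt hpB)) ?_
    (hx.trans hX2) (hy.trans hX2) (hzz.trans hX2)
  have hr : (#(H₁ ∩ H₂) : ℝ) ≤ #H₁ := by exact_mod_cast Finset.card_le_card Finset.inter_subset_left
  calc ‖(#H₁ : ℂ) * (p : ℂ) ^ (-(1 + z.1)) + #H₂ * (p : ℂ) ^ (-(1 + z.2)) -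
        #(H₁ ∩ H₂) * (p : ℂ) ^ (-(1 + z.1 + z.2))‖
      ≤ ‖(#H₁ : ℂ) * (p : ℂ) ^ (-(1 + z.1)) + #H₂ * (p : ℂ) ^ (-(1 + z.2))‖ +
          ‖(#(H₁ ∩ H₂) : ℂ) * (p : ℂ) ^ (-(1 + z.1 + z.2))‖ := norm_sub_le _ _
    _ ≤ ‖(#H₁ : ℂ) * (p : ℂ) ^ (-(1 + z.1))‖ + ‖(#H₂ : ℂ) * (p : ℂ) ^ (-(1 + z.2))‖ +
          ‖(#(H₁ ∩ H₂) : ℂ) * (p : ℂ) ^ (-(1 + z.1 + z.2))‖ := by gcongr; exact norm_add_le _ _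
    _ = #H₁ * ‖(p : ℂ) ^ (-(1 + z.1))‖ + #H₂ * ‖(p : ℂ) ^ (-(1 + z.2))‖ +
          #(H₁ ∩ H₂) * ‖(p : ℂ) ^ (-(1 + z.1 + z.2))‖ := by
        simp only [norm_mul, Complex.norm_natCast]
    _ ≤ #H₁ * X + #H₂ * X + #H₁ * X := by gcongr
    _ ≤ 2 * ((#H₁ + #H₂ : ℕ) : ℝ) * X := by push_cast; nlinarith
    _ ≤ 1 / 2 := hX

/-- **Uniform tail bound on `Ω_η`** (`0 < η ≤ 1/4`), `p > B`:
`‖E_p(s₁,s₂)‖ ≤ 6k² p^{−(1+4η)}`. [cite: GoldstonPintzYildirim2009, Section 7 eq. 7.10] -/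
theorem norm_g₂Log_le_rpow {H₁ H₂ : Finset ℕ} (hk : 1 ≤ #H₁ + #H₂) {η : ℝ} (hη0 : 0 ≤ η)
    (hη : η ≤ 1 / 4) {z : ℂ × ℂ} (hz : z ∈ G₂RegionSub η) {p : ℕ} (hpB : tailBound₂ H₁ H₂ < p) :
    ‖g₂Log #H₁ #H₂ #(H₁ ∩ H₂) p z.1 z.2‖ ≤
      6 * ((#H₁ + #H₂ : ℕ) : ℝ) ^ 2 * (p : ℝ) ^ (-(1 + 4 * η)) := by
  have hp := sixteen_mul_sq_lt_of_tailBound₂_lt hpB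
  have hp0 : 0 < p := by nlinarith
  obtain ⟨hx, hy, hzz, hX⟩ := norms_le_of_mem_sub hk hη0 hη hz hp
  have hr : #(H₁ ∩ H₂) ≤ #H₁ := Finset.card_le_card Finset.inter_subset_left
  have e : ((p : ℝ) ^ (-(1 / 2 + 2 * η))) ^ 2 = (p : ℝ) ^ (-(1 + 4 * η)) := by
    rw [← Real.rpow_natCast ((p : ℝ) ^ (-(1 / 2 + 2 * η))) 2, ← Real.rpow_mul (by positivity)]
    congr 1; push_cast; ring
  have h := norm_g₂Log_le hr hk hx hy hzz hX
  rwa [e] at h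

/-- `∑_p 6k² p^{−1−4η} < ∞` for `η > 0`. [folklore] -/
theorem summable_tail_majorant₂ (H₁ H₂ : Finset ℕ) {η : ℝ} (hη : 0 < η) :
    Summable fun p : Nat.Primes => 6 * ((#H₁ + #H₂ : ℕ) : ℝ) ^ 2 * (p : ℝ) ^ (-(1 + 4 * η)) :=
  (Nat.Primes.summable_rpow.2 (by linarith)).mul_left _

/-- The logarithms of the tail factors (`0` for `p ≤ B`), as functions on `ℂ × ℂ`.
[cite: GoldstonPintzYildirim2009, Section 7 eq. 7.10] -/
def g₂Tail (H₁ H₂ : Finset ℕ) (p : Nat.Primes) (z : ℂ × ℂ) : ℂ :=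
  if (p : ℕ) ≤ tailBound₂ H₁ H₂ then 0 else g₂Log #H₁ #H₂ #(H₁ ∩ H₂) p z.1 z.2

/-- Uniform majorant on `Ω_η`: `‖g₂Tail p z‖ ≤ 6k² p^{−1−4η}`.
[cite: GoldstonPintzYildirim2009, Section 7 eq. 7.10] -/
theorem norm_g₂Tail_le {H₁ H₂ : Finset ℕ} (hk : 1 ≤ #H₁ + #H₂) {η : ℝ} (hη0 : 0 ≤ η)
    (hη : η ≤ 1 / 4) {z : ℂ × ℂ} (hz : z ∈ G₂RegionSub η) (p : Nat.Primes) :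
    ‖g₂Tail H₁ H₂ p z‖ ≤ 6 * ((#H₁ + #H₂ : ℕ) : ℝ) ^ 2 * (p : ℝ) ^ (-(1 + 4 * η)) := by
  unfold g₂Tail
  split_ifs with hp
  · rw [norm_zero]; positivity
  · exact norm_g₂Log_le_rpow hk hη0 hη hz (not_le.1 hp)

/-- `∑_p g₂Tail_p(z)` converges absolutely for `z ∈ Ω`.
[cite: GoldstonPintzYildirim2009, Section 7 eq. 7.10] -/
theorem summable_g₂Tail {H₁ H₂ : Finset ℕ} (hk : 1 ≤ #H₁ + #H₂) {z : ℂ × ℂ} (hz : z ∈ G₂Region) :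
    Summable fun p : Nat.Primes => g₂Tail H₁ H₂ p z := by
  obtain ⟨h1, h2⟩ := hz
  set η : ℝ := min (1 / 4) (min (z.1.re + 1 / 4) (z.2.re + 1 / 4)) / 2 with hηdef
  have hη0 : 0 < η := by
    rw [hηdef]; refine div_pos (lt_min (by norm_num) (lt_min (by linarith) (by linarith))) two_pos
  have hη4 : η ≤ 1 / 4 := by
    rw [hηdef]; have := min_le_left (1 / 4 : ℝ) (min (z.1.re + 1 / 4) (z.2.re + 1 / 4)); linarith
  have hz' : z ∈ G₂RegionSub η := by
    have hm1 := (min_le_right (1 / 4 : ℝ) _).trans (min_le_left (z.1.re + 1 / 4) (z.2.re + 1 / 4))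
    have hm2 := (min_le_right (1 / 4 : ℝ) _).trans (min_le_right (z.1.re + 1 / 4) (z.2.re + 1 / 4))
    constructor
    · show -1 / 4 + η < z.1.re
      rw [hηdef]; linarith
    · show -1 / 4 + η < z.2.re
      rw [hηdef]; linarith
  exact Summable.of_norm_bounded (summable_tail_majorant₂ H₁ H₂ hη0)
    (fun p => norm_g₂Tail_le hk hη0.le hη4 hz' p)

/-- **GPY (7.10), convergence**: for `z = (s₁,s₂) ∈ Ω`,
`G(s₁,s₂) = ∏_{p ≤ B} G₂Factor_p(s₁,s₂) · exp(∑_{p > B} E_p(s₁,s₂))` as a convergent product.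
[cite: GoldstonPintzYildirim2009, Section 7 eq. 7.10] -/
theorem hasProd_G₂Factor_of_mem {H₁ H₂ : Finset ℕ} (hk : 1 ≤ #H₁ + #H₂) {z : ℂ × ℂ}
    (hz : z ∈ G₂Region) :
    HasProd (fun p : Nat.Primes => G₂Factor H₁ H₂ p z.1 z.2)
      ((∏ p ∈ smallPrimes (tailBound₂ H₁ H₂), G₂Factor H₁ H₂ p z.1 z.2) *
        Complex.exp (∑' p : Nat.Primes, g₂Tail H₁ H₂ p z)) := by
  set B := tailBound₂ H₁ H₂ with hB
  have hA : HasProd (fun p : Nat.Primes => if (p : ℕ) ≤ B then G₂Factor H₁ H₂ p z.1 z.2 else 1)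
      (∏ p ∈ smallPrimes B, G₂Factor H₁ H₂ p z.1 z.2) := by
    have h : HasProd (fun p : Nat.Primes => if (p : ℕ) ≤ B then G₂Factor H₁ H₂ p z.1 z.2 else 1)
        (∏ p ∈ smallPrimes B, (if (p : ℕ) ≤ B then G₂Factor H₁ H₂ p z.1 z.2 else 1)) :=
      hasProd_prod_of_ne_finset_one (fun p hp => if_neg (mt mem_smallPrimes.2 hp))
    rwa [Finset.prod_congr rfl (fun p hp => if_pos (mem_smallPrimes.1 hp))] at h
  have hE : HasProd (fun p : Nat.Primes => Complex.exp (g₂Tail H₁ H₂ p z))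
      (Complex.exp (∑' p : Nat.Primes, g₂Tail H₁ H₂ p z)) :=
    (summable_g₂Tail hk hz).hasSum.cexp
  have h := hA.mul hE
  convert h using 1
  funext p
  by_cases hp : (p : ℕ) ≤ B
  · simp [g₂Tail, ← hB, hp]
  · rw [if_neg hp, one_mul, g₂Tail, ← hB, if_neg hp, G₂Factor_eq_exp_g₂Log hk (not_le.1 hp) hz]

/-- `G = ∏_{p ≤ B} G₂Factor_p · exp(∑_p g₂Tail_p)` on `Ω`. [cite: GoldstonPintzYildirim2009, Section 7 eq. 7.10] -/
theorem G₂_eq_prod_mul_exp {H₁ H₂ : Finset ℕ} (hk : 1 ≤ #H₁ + #H₂) {z : ℂ × ℂ} (hz : z ∈ G₂Region) :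
    G₂ H₁ H₂ z.1 z.2 = (∏ p ∈ smallPrimes (tailBound₂ H₁ H₂), G₂Factor H₁ H₂ p z.1 z.2) *
      Complex.exp (∑' p : Nat.Primes, g₂Tail H₁ H₂ p z) :=
  (hasProd_G₂Factor_of_mem hk hz).tprod_eq

/-- The Euler product of `G` converges on `Ω`. [cite: GoldstonPintzYildirim2009, Section 7 eq. 7.10] -/
theorem multipliable_G₂Factor {H₁ H₂ : Finset ℕ} (hk : 1 ≤ #H₁ + #H₂) {z : ℂ × ℂ} (hz : z ∈ G₂Region) :
    Multipliable fun p : Nat.Primes => G₂Factor H₁ H₂ p z.1 z.2 :=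
  ⟨_, hasProd_G₂Factor_of_mem hk hz⟩

/-! #### Differentiability of the factors and of the tail logarithms on `ℂ × ℂ` -/

/-- `z ↦ p^{−(1+z₁)}` is differentiable on `ℂ × ℂ`. [folklore] -/
theorem differentiableAt_cpow_neg_fst {p : ℕ} (hp : 0 < p) (z : ℂ × ℂ) :
    DifferentiableAt ℂ (fun z : ℂ × ℂ => (p : ℂ) ^ (-(1 + z.1))) z :=
  ((differentiableAt_fst.const_add (1 : ℂ)).neg).const_cpow (Or.inl (by exact_mod_cast hp.ne'))

/-- `z ↦ p^{−(1+z₂)}` is differentiable on `ℂ × ℂ`. [folklore] -/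
theorem differentiableAt_cpow_neg_snd {p : ℕ} (hp : 0 < p) (z : ℂ × ℂ) :
    DifferentiableAt ℂ (fun z : ℂ × ℂ => (p : ℂ) ^ (-(1 + z.2))) z :=
  ((differentiableAt_snd.const_add (1 : ℂ)).neg).const_cpow (Or.inl (by exact_mod_cast hp.ne'))

/-- `z ↦ p^{−(1+z₁+z₂)}` is differentiable on `ℂ × ℂ`. [folklore] -/
theorem differentiableAt_cpow_neg_add {p : ℕ} (hp : 0 < p) (z : ℂ × ℂ) :
    DifferentiableAt ℂ (fun z : ℂ × ℂ => (p : ℂ) ^ (-(1 + z.1 + z.2))) z :=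
  (((differentiableAt_fst.const_add (1 : ℂ)).add differentiableAt_snd).neg).const_cpow
    (Or.inl (by exact_mod_cast hp.ne'))

/-- `‖p^{−(1+s)}‖ < 1` for `Re s > −1`, so `1 − p^{−(1+s)} ≠ 0`. [folklore] -/
theorem one_sub_cpow_ne_zero {p : ℕ} (hp : p.Prime) {s : ℂ} (hs : -1 < s.re) :
    1 - (p : ℂ) ^ (-(1 + s)) ≠ 0 := by
  have hz1 : ‖(p : ℂ) ^ (-(1 + s))‖ < 1 := by
    rw [norm_natCast_cpow_neg hp.pos]
    exact Real.rpow_lt_one_of_one_lt_of_neg (by exact_mod_cast hp.one_lt) (by linarith)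
  intro h0
  have : (p : ℂ) ^ (-(1 + s)) = 1 := by linear_combination -h0
  rw [this, norm_one] at hz1
  exact lt_irrefl _ hz1

/-- `F₂Factor` with negative exponents: `1 − ν₁ p^{−(1+s₁)} − ν₂ p^{−(1+s₂)} + ν̄ p^{−(1+s₁+s₂)}`.
[cite: GoldstonPintzYildirim2009, Section 7 eq. 7.8] -/
theorem F₂Factor_eq_sub_mul (H₁ H₂ : Finset ℕ) (p : ℕ) (s₁ s₂ : ℂ) :
    F₂Factor H₁ H₂ p s₁ s₂ = 1 - (nuPrime H₁ p : ℂ) * (p : ℂ) ^ (-(1 + s₁)) -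
      (nuPrime H₂ p : ℂ) * (p : ℂ) ^ (-(1 + s₂)) + (nuBar H₁ H₂ p : ℂ) * (p : ℂ) ^ (-(1 + s₁ + s₂)) := by
  simp only [F₂Factor, Complex.cpow_neg, div_eq_mul_inv]

/-- Each Euler factor of `G` is (jointly) differentiable at points with `Re s₁, Re s₂ > −1`.
[cite: GoldstonPintzYildirim2009, Section 7 eq. 7.10] -/
theorem differentiableAt_G₂Factor (H₁ H₂ : Finset ℕ) {p : ℕ} (hp : p.Prime) {z : ℂ × ℂ}
    (h1 : -1 < z.1.re) (h2 : -1 < z.2.re) :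
    DifferentiableAt ℂ (fun z : ℂ × ℂ => G₂Factor H₁ H₂ p z.1 z.2) z := by
  have hp0 : 0 < p := hp.pos
  have hx := differentiableAt_cpow_neg_fst hp0 z
  have hy := differentiableAt_cpow_neg_snd hp0 z
  have hxy := differentiableAt_cpow_neg_add hp0 z
  have hw1 := one_sub_cpow_ne_zero hp h1
  have hw2 := one_sub_cpow_ne_zero hp h2
  have heq : (fun z : ℂ × ℂ => G₂Factor H₁ H₂ p z.1 z.2) = fun z : ℂ × ℂ =>
      (1 - (nuPrime H₁ p : ℂ) * (p : ℂ) ^ (-(1 + z.1)) - (nuPrime H₂ p : ℂ) * (p : ℂ) ^ (-(1 + z.2)) +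
        (nuBar H₁ H₂ p : ℂ) * (p : ℂ) ^ (-(1 + z.1 + z.2))) *
      (1 - (p : ℂ) ^ (-(1 + z.1 + z.2))) ^ #(H₁ ∩ H₂) *
      ((1 - (p : ℂ) ^ (-(1 + z.1)))⁻¹) ^ #H₁ * ((1 - (p : ℂ) ^ (-(1 + z.2)))⁻¹) ^ #H₂ := by
    funext z
    rw [G₂Factor, F₂Factor_eq_sub_mul]
  rw [heq]
  have hF : DifferentiableAt ℂ (fun z : ℂ × ℂ =>
      1 - (nuPrime H₁ p : ℂ) * (p : ℂ) ^ (-(1 + z.1)) - (nuPrime H₂ p : ℂ) * (p : ℂ) ^ (-(1 + z.2)) +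
        (nuBar H₁ H₂ p : ℂ) * (p : ℂ) ^ (-(1 + z.1 + z.2))) z :=
    (((differentiableAt_const _).sub (hx.const_mul _)).sub (hy.const_mul _)).add (hxy.const_mul _)
  have hZ : DifferentiableAt ℂ (fun z : ℂ × ℂ => (1 - (p : ℂ) ^ (-(1 + z.1 + z.2))) ^ #(H₁ ∩ H₂)) z :=
    ((differentiableAt_const _).sub hxy).pow _
  have hX : DifferentiableAt ℂ (fun z : ℂ × ℂ => ((1 - (p : ℂ) ^ (-(1 + z.1)))⁻¹) ^ #H₁) z :=
    (((differentiableAt_const _).sub hx).inv hw1).pow _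
  have hY : DifferentiableAt ℂ (fun z : ℂ × ℂ => ((1 - (p : ℂ) ^ (-(1 + z.2)))⁻¹) ^ #H₂) z :=
    (((differentiableAt_const _).sub hy).inv hw2).pow _
  exact ((hF.mul hZ).mul hX).mul hY

/-- `E_p` is differentiable where `‖k₁x + k₂y − rz‖, ‖x‖, ‖y‖, ‖z‖ ≤ 1/2`.
[cite: GoldstonPintzYildirim2009, Section 7 eq. 7.10] -/
theorem differentiableAt_g₂Log {k₁ k₂ r p : ℕ} (hp : 0 < p) {z : ℂ × ℂ}
    (hw : ‖(k₁ : ℂ) * (p : ℂ) ^ (-(1 + z.1)) + k₂ * (p : ℂ) ^ (-(1 + z.2)) -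
      r * (p : ℂ) ^ (-(1 + z.1 + z.2))‖ ≤ 1 / 2)
    (hx : ‖(p : ℂ) ^ (-(1 + z.1))‖ ≤ 1 / 2) (hy : ‖(p : ℂ) ^ (-(1 + z.2))‖ ≤ 1 / 2)
    (hz : ‖(p : ℂ) ^ (-(1 + z.1 + z.2))‖ ≤ 1 / 2) :
    DifferentiableAt ℂ (fun z : ℂ × ℂ => g₂Log k₁ k₂ r p z.1 z.2) z := by
  have hdx := differentiableAt_cpow_neg_fst hp z
  have hdy := differentiableAt_cpow_neg_snd hp z
  have hdz := differentiableAt_cpow_neg_add hp z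
  have hmain : 1 - (k₁ : ℂ) * (p : ℂ) ^ (-(1 + z.1)) - k₂ * (p : ℂ) ^ (-(1 + z.2)) +
      r * (p : ℂ) ^ (-(1 + z.1 + z.2)) ∈ Complex.slitPlane := by
    have : (1 : ℂ) - k₁ * (p : ℂ) ^ (-(1 + z.1)) - k₂ * (p : ℂ) ^ (-(1 + z.2)) +
        r * (p : ℂ) ^ (-(1 + z.1 + z.2)) =
        1 - ((k₁ : ℂ) * (p : ℂ) ^ (-(1 + z.1)) + k₂ * (p : ℂ) ^ (-(1 + z.2)) -
          r * (p : ℂ) ^ (-(1 + z.1 + z.2))) := by ring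
    rw [this]
    exact Complex.mem_slitPlane_iff.2 (Or.inl (re_one_sub_pos_of_norm_le_half hw))
  unfold g₂Log
  refine ((DifferentiableAt.add ?_ ?_).sub ?_).sub ?_
  · exact ((((differentiableAt_const _).sub (hdx.const_mul _)).sub (hdy.const_mul _)).add
      (hdz.const_mul _)).clog hmain
  · exact (((differentiableAt_const _).sub hdz).clog
      (Complex.mem_slitPlane_iff.2 (Or.inl (re_one_sub_pos_of_norm_le_half hz)))).const_mul _
  · exact (((differentiableAt_const _).sub hdx).clog
      (Complex.mem_slitPlane_iff.2 (Or.inl (re_one_sub_pos_of_norm_le_half hx)))).const_mul _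
  · exact (((differentiableAt_const _).sub hdy).clog
      (Complex.mem_slitPlane_iff.2 (Or.inl (re_one_sub_pos_of_norm_le_half hy)))).const_mul _

/-- Each `g₂Tail p` is differentiable on `Ω_η` (`0 ≤ η ≤ 1/4`).
[cite: GoldstonPintzYildirim2009, Section 7 eq. 7.10] -/
theorem differentiableOn_g₂Tail {H₁ H₂ : Finset ℕ} (hk : 1 ≤ #H₁ + #H₂) {η : ℝ} (hη0 : 0 ≤ η)
    (hη : η ≤ 1 / 4) (p : Nat.Primes) :
    DifferentiableOn ℂ (g₂Tail H₁ H₂ p) (G₂RegionSub η) := by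
  intro z hz
  by_cases hp : (p : ℕ) ≤ tailBound₂ H₁ H₂
  · have : g₂Tail H₁ H₂ p = fun _ => 0 := funext fun z => if_pos hp
    rw [this]
    exact (differentiableAt_const _).differentiableWithinAt
  · have : g₂Tail H₁ H₂ p = fun z => g₂Log #H₁ #H₂ #(H₁ ∩ H₂) p z.1 z.2 := funext fun z => if_neg hp
    rw [this]
    rw [not_le] at hp
    have hp16 := sixteen_mul_sq_lt_of_tailBound₂_lt hp
    obtain ⟨hx, hy, hzz, hX⟩ := norms_le_of_mem_sub hk hη0 hη hz hp16
    set X : ℝ := (p : ℝ) ^ (-(1 / 2 + 2 * η)) with hXdef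
    have hk1 : (1 : ℝ) ≤ ((#H₁ + #H₂ : ℕ) : ℝ) := by exact_mod_cast hk
    have hX0 : 0 ≤ X := (norm_nonneg _).trans hx
    have hX2 : X ≤ 1 / 2 := by nlinarith
    refine (differentiableAt_g₂Log p.2.pos ?_ (hx.trans hX2) (hy.trans hX2) (hzz.trans hX2)).differentiableWithinAt
    calc ‖(#H₁ : ℂ) * (p : ℂ) ^ (-(1 + z.1)) + #H₂ * (p : ℂ) ^ (-(1 + z.2)) -
          #(H₁ ∩ H₂) * (p : ℂ) ^ (-(1 + z.1 + z.2))‖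
        ≤ ‖(#H₁ : ℂ) * (p : ℂ) ^ (-(1 + z.1)) + #H₂ * (p : ℂ) ^ (-(1 + z.2))‖ +
            ‖(#(H₁ ∩ H₂) : ℂ) * (p : ℂ) ^ (-(1 + z.1 + z.2))‖ := norm_sub_le _ _
      _ ≤ ‖(#H₁ : ℂ) * (p : ℂ) ^ (-(1 + z.1))‖ + ‖(#H₂ : ℂ) * (p : ℂ) ^ (-(1 + z.2))‖ +
            ‖(#(H₁ ∩ H₂) : ℂ) * (p : ℂ) ^ (-(1 + z.1 + z.2))‖ := by gcongr; exact norm_add_le _ _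
      _ = #H₁ * ‖(p : ℂ) ^ (-(1 + z.1))‖ + #H₂ * ‖(p : ℂ) ^ (-(1 + z.2))‖ +
            #(H₁ ∩ H₂) * ‖(p : ℂ) ^ (-(1 + z.1 + z.2))‖ := by
          simp only [norm_mul, Complex.norm_natCast]
      _ ≤ #H₁ * X + #H₂ * X + #H₁ * X := by
          have hr : (#(H₁ ∩ H₂) : ℝ) ≤ #H₁ := by
            exact_mod_cast Finset.card_le_card Finset.inter_subset_left
          gcongr
      _ ≤ 2 * ((#H₁ + #H₂ : ℕ) : ℝ) * X := by push_cast; nlinarith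
      _ ≤ 1 / 2 := hX

/-- **GPY (7.10)**: `G` is jointly holomorphic on `Ω = {Re s₁, Re s₂ > −1/4}` (as a map on `ℂ × ℂ`):
finite product of holomorphic factors times `exp` of a normally convergent series of holomorphic
maps (several-variable Weierstrass `M`-test). [cite: GoldstonPintzYildirim2009, Section 7 eq. 7.10] -/
theorem differentiableOn_G₂ {H₁ H₂ : Finset ℕ} (hk : 1 ≤ #H₁ + #H₂) :
    DifferentiableOn ℂ (fun z : ℂ × ℂ => G₂ H₁ H₂ z.1 z.2) G₂Region := by
  intro z hz
  obtain ⟨h1, h2⟩ := hz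
  set η : ℝ := min (1 / 4) (min (z.1.re + 1 / 4) (z.2.re + 1 / 4)) / 2 with hηdef
  have hη0 : 0 < η := by
    rw [hηdef]; refine div_pos (lt_min (by norm_num) (lt_min (by linarith) (by linarith))) two_pos
  have hη4 : η ≤ 1 / 4 := by
    rw [hηdef]; have := min_le_left (1 / 4 : ℝ) (min (z.1.re + 1 / 4) (z.2.re + 1 / 4)); linarith
  set U : Set (ℂ × ℂ) := G₂RegionSub η with hU
  have hUo : IsOpen U := isOpen_G₂RegionSub η
  have hzU : z ∈ U := by
    have hm1 := (min_le_right (1 / 4 : ℝ) _).trans (min_le_left (z.1.re + 1 / 4) (z.2.re + 1 / 4))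
    have hm2 := (min_le_right (1 / 4 : ℝ) _).trans (min_le_right (z.1.re + 1 / 4) (z.2.re + 1 / 4))
    constructor
    · show -1 / 4 + η < z.1.re
      rw [hηdef]; linarith
    · show -1 / 4 + η < z.2.re
      rw [hηdef]; linarith
  have hsub : U ⊆ G₂Region := fun w hw => ⟨by have := hw.1; linarith, by have := hw.2; linarith⟩
  have hdiff : DifferentiableOn ℂ (fun w : ℂ × ℂ =>
      (∏ p ∈ smallPrimes (tailBound₂ H₁ H₂), G₂Factor H₁ H₂ p w.1 w.2) *
        Complex.exp (∑' p : Nat.Primes, g₂Tail H₁ H₂ p w)) U := by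
    refine DifferentiableOn.mul ?_ ?_
    · intro w hw
      classical
      have h := HasFDerivAt.finsetProd (u := smallPrimes (tailBound₂ H₁ H₂))
        (g := fun (p : Nat.Primes) (w : ℂ × ℂ) => G₂Factor H₁ H₂ p w.1 w.2) (x := w)
        (fun p _ => (differentiableAt_G₂Factor H₁ H₂ p.2
          (by have := (hsub hw).1; linarith) (by have := (hsub hw).2; linarith)).hasFDerivAt)
      exact h.differentiableAt.differentiableWithinAt
    · exact (Literature.Analysis.Complex.SCV.analyticOnNhd_tsum_of_summable_norm hUo
        (fun p => differentiableOn_g₂Tail hk hη0.le hη4 p) (summable_tail_majorant₂ H₁ H₂ hη0)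
        (fun p w hw => norm_g₂Tail_le hk hη0.le hη4 hw p)).differentiableOn.cexp
  have hGU : DifferentiableOn ℂ (fun w : ℂ × ℂ => G₂ H₁ H₂ w.1 w.2) U :=
    hdiff.congr fun w hw => G₂_eq_prod_mul_exp hk (hsub hw)
  exact (hGU.differentiableAt (hUo.mem_nhds hzU)).differentiableWithinAt

/-- `G` is continuous on `Ω`. [cite: GoldstonPintzYildirim2009, Section 7 eq. 7.10] -/
theorem continuousOn_G₂ {H₁ H₂ : Finset ℕ} (hk : 1 ≤ #H₁ + #H₂) :
    ContinuousOn (fun z : ℂ × ℂ => G₂ H₁ H₂ z.1 z.2) G₂Region :=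
  (differentiableOn_G₂ hk).continuousOn

/-- Slices: for fixed `s₂` with `Re s₂ > −1/4`, `s₁ ↦ G(s₁,s₂)` is holomorphic on `Re s₁ > −1/4`.
[cite: GoldstonPintzYildirim2009, Section 7 eq. 7.10] -/
theorem differentiableOn_G₂_fst {H₁ H₂ : Finset ℕ} (hk : 1 ≤ #H₁ + #H₂) {s₂ : ℂ} (hs₂ : -1 / 4 < s₂.re) :
    DifferentiableOn ℂ (fun s₁ : ℂ => G₂ H₁ H₂ s₁ s₂) {s₁ : ℂ | -1 / 4 < s₁.re} := by
  intro s₁ hs₁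
  have h := (differentiableOn_G₂ hk).differentiableAt (x := (s₁, s₂))
    (isOpen_G₂Region.mem_nhds ⟨hs₁, hs₂⟩)
  have hi : DifferentiableAt ℂ (fun s : ℂ => (s, s₂)) s₁ := differentiableAt_id.prodMk (differentiableAt_const _)
  exact (h.comp s₁ hi).differentiableWithinAt

/-- Slices: for fixed `s₁` with `Re s₁ > −1/4`, `s₂ ↦ G(s₁,s₂)` is holomorphic on `Re s₂ > −1/4`.
[cite: GoldstonPintzYildirim2009, Section 7 eq. 7.10] -/
theorem differentiableOn_G₂_snd {H₁ H₂ : Finset ℕ} (hk : 1 ≤ #H₁ + #H₂) {s₁ : ℂ} (hs₁ : -1 / 4 < s₁.re) :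
    DifferentiableOn ℂ (fun s₂ : ℂ => G₂ H₁ H₂ s₁ s₂) {s₂ : ℂ | -1 / 4 < s₂.re} := by
  intro s₂ hs₂
  have h := (differentiableOn_G₂ hk).differentiableAt (x := (s₁, s₂))
    (isOpen_G₂Region.mem_nhds ⟨hs₁, hs₂⟩)
  have hi : DifferentiableAt ℂ (fun s : ℂ => (s₁, s)) s₂ := (differentiableAt_const _).prodMk differentiableAt_id
  exact (h.comp s₂ hi).differentiableWithinAt

/-! ### GPY (7.12): the bound for `G` on `−1/8 ≤ σ₁, σ₂`

With `δᵢ = max(−σᵢ, 0)`, `δ = δ₁ + δ₂ ≤ 1/4` and `σ* = −δ ∈ [−1/4, 0]`, all of `|p^{−1−s₁}|`,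
`|p^{−1−s₂}|`, `|p^{−1−s₁−s₂}|` are `≤ X_p = p^{−(1+σ*)} = p^{δ−1}`, and the factors of `G` obey the
same two bounds as those of `G_H` in (6.16) with `k` replaced by `k' = 2(k₁+k₂)`; the three prime
sums of `GoldstonPintzYildirimEulerProduct` then give (7.12). -/

/-- `gpyU` is monotone in `k`. [cite: GoldstonPintzYildirim2009, Section 6 eq. 6.14] -/
theorem gpyU_mono {k k' : ℕ} (hk : k ≤ k') (h : ℕ) : gpyU k h ≤ gpyU k' h := by
  unfold gpyU
  have hk' : (k : ℝ) ≤ k' := by exact_mod_cast hk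
  have hlog : 0 ≤ Real.log (2 * h) := by
    rcases Nat.eq_zero_or_pos h with rfl | hpos
    · simp
    · have h1 : (1 : ℝ) ≤ h := by exact_mod_cast hpos
      exact Real.log_nonneg (by linarith)
  refine max_le_max (max_le_max le_rfl (by nlinarith)) ?_
  exact mul_le_mul_of_nonneg_right (by nlinarith) hlog

/-- The exponent bookkeeping: with `δ = max(−σ₁,0) + max(−σ₂,0)`, for `p ≥ 1`,
`|p^{−(1+s₁)}|, |p^{−(1+s₂)}|, |p^{−(1+s₁+s₂)}| ≤ p^{−(1−δ)}`. [cite: GoldstonPintzYildirim2009, Section 7 eq. 7.12] -/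
theorem norms_le_rpow_delta {p : ℕ} (hp : 0 < p) (s₁ s₂ : ℂ) :
    ‖(p : ℂ) ^ (-(1 + s₁))‖ ≤ (p : ℝ) ^ (-(1 + -(max (-s₁.re) 0 + max (-s₂.re) 0))) ∧
    ‖(p : ℂ) ^ (-(1 + s₂))‖ ≤ (p : ℝ) ^ (-(1 + -(max (-s₁.re) 0 + max (-s₂.re) 0))) ∧
    ‖(p : ℂ) ^ (-(1 + s₁ + s₂))‖ ≤ (p : ℝ) ^ (-(1 + -(max (-s₁.re) 0 + max (-s₂.re) 0))) := by
  have hp1 : (1 : ℝ) ≤ p := by exact_mod_cast hp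
  have h1 := le_max_left (-s₁.re) 0
  have h1' := le_max_right (-s₁.re) 0
  have h2 := le_max_left (-s₂.re) 0
  have h2' := le_max_right (-s₂.re) 0
  refine ⟨?_, ?_, ?_⟩
  · rw [norm_natCast_cpow_neg hp]
    exact Real.rpow_le_rpow_of_exponent_le hp1 (by linarith)
  · rw [norm_natCast_cpow_neg hp]
    exact Real.rpow_le_rpow_of_exponent_le hp1 (by linarith)
  · rw [norm_natCast_cpow_neg_add hp]
    exact Real.rpow_le_rpow_of_exponent_le hp1 (by linarith)

/-- For every prime `p` and `δ ≤ 1/4`, with `X = p^{−(1+σ*)}` (`σ* = −δ`, so `X ≤ 2^{−3/4} ≤ 2/3`):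
`|G₂Factor_p(s₁,s₂)| ≤ (1 + 2kX)(1 + X)^r (1 + 3X)^{k₁}(1 + 3X)^{k₂} ≤ e^{8kX} = e^{4k'X}`, `k' = 2k`.
[cite: GoldstonPintzYildirim2009, Section 7 eq. 7.12] -/
theorem norm_G₂Factor_le_exp (H₁ H₂ : Finset ℕ) {p : ℕ} (hp : p.Prime) {s₁ s₂ : ℂ}
    (hδ : max (-s₁.re) 0 + max (-s₂.re) 0 ≤ 1 / 4) :
    ‖G₂Factor H₁ H₂ p s₁ s₂‖ ≤
      Real.exp (4 * ((2 * (#H₁ + #H₂) : ℕ) : ℝ) *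
        (p : ℝ) ^ (-(1 + -(max (-s₁.re) 0 + max (-s₂.re) 0)))) := by
  set δ : ℝ := max (-s₁.re) 0 + max (-s₂.re) 0 with hδdef
  set X : ℝ := (p : ℝ) ^ (-(1 + -δ)) with hXdef
  set k : ℕ := #H₁ + #H₂ with hkdef
  have hp0 := hp.pos
  obtain ⟨hx, hy, hz⟩ := norms_le_rpow_delta hp0 s₁ s₂
  rw [← hδdef] at hx hy hz
  have hX0 : 0 ≤ X := by positivity
  have hδ0 : 0 ≤ δ := add_nonneg (le_max_right _ _) (le_max_right _ _)
  have hX23 : X ≤ 2 / 3 := by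
    calc X ≤ (p : ℝ) ^ (-(3 / 4 : ℝ)) :=
          Real.rpow_le_rpow_of_exponent_le (by exact_mod_cast hp.one_lt.le) (by linarith)
      _ ≤ (2 : ℝ) ^ (-(3 / 4 : ℝ)) :=
          Real.rpow_le_rpow_of_nonpos (by norm_num) (by exact_mod_cast hp.two_le) (by norm_num)
      _ ≤ 2 / 3 := two_rpow_neg_three_quarters_le
  have hksum : (k : ℝ) = #H₁ + #H₂ := by rw [hkdef]; push_cast; ring
  have hk₁ : (#H₁ : ℝ) ≤ k := by rw [hksum]; linarith [(Nat.cast_nonneg #H₂ : (0 : ℝ) ≤ #H₂)]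
  have hk₂ : (#H₂ : ℝ) ≤ k := by rw [hksum]; linarith [(Nat.cast_nonneg #H₁ : (0 : ℝ) ≤ #H₁)]
  have hr : (#(H₁ ∩ H₂) : ℝ) ≤ #H₁ := by exact_mod_cast Finset.card_le_card Finset.inter_subset_left
  -- first factor
  have h1 : ‖F₂Factor H₁ H₂ p s₁ s₂‖ ≤ Real.exp (2 * k * X) := by
    rw [F₂Factor_eq_sub_mul]
    calc ‖1 - (nuPrime H₁ p : ℂ) * (p : ℂ) ^ (-(1 + s₁)) - (nuPrime H₂ p : ℂ) * (p : ℂ) ^ (-(1 + s₂)) +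
          (nuBar H₁ H₂ p : ℂ) * (p : ℂ) ^ (-(1 + s₁ + s₂))‖
        ≤ ‖(1 : ℂ) - (nuPrime H₁ p : ℂ) * (p : ℂ) ^ (-(1 + s₁)) - (nuPrime H₂ p : ℂ) * (p : ℂ) ^ (-(1 + s₂))‖ +
            ‖(nuBar H₁ H₂ p : ℂ) * (p : ℂ) ^ (-(1 + s₁ + s₂))‖ := norm_add_le _ _
      _ ≤ ‖(1 : ℂ) - (nuPrime H₁ p : ℂ) * (p : ℂ) ^ (-(1 + s₁))‖ + ‖(nuPrime H₂ p : ℂ) * (p : ℂ) ^ (-(1 + s₂))‖ +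
            ‖(nuBar H₁ H₂ p : ℂ) * (p : ℂ) ^ (-(1 + s₁ + s₂))‖ := by gcongr; exact norm_sub_le _ _
      _ ≤ ‖(1 : ℂ)‖ + ‖(nuPrime H₁ p : ℂ) * (p : ℂ) ^ (-(1 + s₁))‖ + ‖(nuPrime H₂ p : ℂ) * (p : ℂ) ^ (-(1 + s₂))‖ +
            ‖(nuBar H₁ H₂ p : ℂ) * (p : ℂ) ^ (-(1 + s₁ + s₂))‖ := by gcongr; exact norm_sub_le _ _
      _ = 1 + nuPrime H₁ p * ‖(p : ℂ) ^ (-(1 + s₁))‖ + nuPrime H₂ p * ‖(p : ℂ) ^ (-(1 + s₂))‖ +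
            nuBar H₁ H₂ p * ‖(p : ℂ) ^ (-(1 + s₁ + s₂))‖ := by
          simp only [norm_one, norm_mul, Complex.norm_natCast]
      _ ≤ 1 + #H₁ * X + #H₂ * X + #H₁ * X := by
          have e1 : (nuPrime H₁ p : ℝ) ≤ #H₁ := by exact_mod_cast nuPrime_le_card H₁ p
          have e2 : (nuPrime H₂ p : ℝ) ≤ #H₂ := by exact_mod_cast nuPrime_le_card H₂ p
          have e3 : (nuBar H₁ H₂ p : ℝ) ≤ #H₁ := by
            have : nuBar H₁ H₂ p ≤ #H₁ := by
              rw [nuBar_eq_card_inter]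
              exact (Finset.card_le_card Finset.inter_subset_left).trans Finset.card_image_le
            exact_mod_cast this
          gcongr
      _ ≤ 1 + 2 * k * X := by
          rw [hksum]; nlinarith [mul_nonneg (Nat.cast_nonneg #H₂ : (0 : ℝ) ≤ #H₂) hX0]
      _ ≤ Real.exp (2 * k * X) := by linarith [Real.add_one_le_exp (2 * (k : ℝ) * X)]
  -- second factor `(1 - z)^r`
  have h2 : ‖(1 - (p : ℂ) ^ (-(1 + s₁ + s₂))) ^ #(H₁ ∩ H₂)‖ ≤ Real.exp (k * X) := by
    rw [norm_pow]
    have hb : ‖1 - (p : ℂ) ^ (-(1 + s₁ + s₂))‖ ≤ 1 + X :=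
      calc ‖1 - (p : ℂ) ^ (-(1 + s₁ + s₂))‖ ≤ ‖(1 : ℂ)‖ + ‖(p : ℂ) ^ (-(1 + s₁ + s₂))‖ := norm_sub_le _ _
        _ ≤ 1 + X := by rw [norm_one]; gcongr
    calc ‖1 - (p : ℂ) ^ (-(1 + s₁ + s₂))‖ ^ #(H₁ ∩ H₂) ≤ (1 + X) ^ #(H₁ ∩ H₂) :=
          pow_le_pow_left₀ (norm_nonneg _) hb _
      _ ≤ Real.exp X ^ #(H₁ ∩ H₂) :=
          pow_le_pow_left₀ (by positivity) (by linarith [Real.add_one_le_exp X]) _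
      _ = Real.exp (#(H₁ ∩ H₂) * X) := by rw [← Real.exp_nat_mul]
      _ ≤ Real.exp (k * X) := Real.exp_le_exp.2 (mul_le_mul_of_nonneg_right (hr.trans hk₁) hX0)
  -- third and fourth factors
  have hinv : ∀ s : ℂ, ‖(p : ℂ) ^ (-(1 + s))‖ ≤ X → ∀ m : ℕ,
      ‖((1 - (p : ℂ) ^ (-(1 + s)))⁻¹) ^ m‖ ≤ Real.exp (3 * m * X) := by
    intro s hs m
    rw [norm_pow, norm_inv]
    have hlow : 1 - X ≤ ‖1 - (p : ℂ) ^ (-(1 + s))‖ := by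
      have := norm_sub_norm_le (1 : ℂ) ((p : ℂ) ^ (-(1 + s)))
      rw [norm_one] at this; linarith
    have h1x : 0 < 1 - X := by linarith
    have hi : ‖1 - (p : ℂ) ^ (-(1 + s))‖⁻¹ ≤ 1 + 3 * X := by
      refine (inv_anti₀ h1x hlow).trans ?_
      rw [inv_eq_one_div, div_le_iff₀ h1x]
      nlinarith
    calc ‖1 - (p : ℂ) ^ (-(1 + s))‖⁻¹ ^ m ≤ (1 + 3 * X) ^ m := pow_le_pow_left₀ (by positivity) hi _
      _ ≤ Real.exp (3 * X) ^ m :=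
          pow_le_pow_left₀ (by positivity) (by linarith [Real.add_one_le_exp (3 * X)]) _
      _ = Real.exp (m * (3 * X)) := by rw [← Real.exp_nat_mul]
      _ = Real.exp (3 * m * X) := by ring_nf
  have h3 := hinv s₁ hx #H₁
  have h4 := hinv s₂ hy #H₂
  have hkk : ((2 * (#H₁ + #H₂) : ℕ) : ℝ) = 2 * k := by rw [hkdef]; push_cast; ring
  calc ‖G₂Factor H₁ H₂ p s₁ s₂‖
      = ‖F₂Factor H₁ H₂ p s₁ s₂‖ * ‖(1 - (p : ℂ) ^ (-(1 + s₁ + s₂))) ^ #(H₁ ∩ H₂)‖ *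
          ‖((1 - (p : ℂ) ^ (-(1 + s₁)))⁻¹) ^ #H₁‖ * ‖((1 - (p : ℂ) ^ (-(1 + s₂)))⁻¹) ^ #H₂‖ := by
        rw [G₂Factor, norm_mul, norm_mul, norm_mul]
    _ ≤ Real.exp (2 * k * X) * Real.exp (k * X) * Real.exp (3 * #H₁ * X) * Real.exp (3 * #H₂ * X) := by
        gcongr
    _ = Real.exp (6 * k * X) := by
        rw [← Real.exp_add, ← Real.exp_add, ← Real.exp_add, hksum]; ring_nf
    _ ≤ Real.exp (4 * ((2 * (#H₁ + #H₂) : ℕ) : ℝ) * X) := by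
        rw [hkk]
        exact Real.exp_le_exp.2 (by nlinarith)

/-- For `p > U' = gpyU k' h` (`k' = 2k`), `p ∤ Δ(H₁ ∪ H₂)` and `δ ≤ 1/4`: `p` is generic, `k'X ≤ 1/2`,
the factor is `exp(E_p)` with `|E_p| ≤ 6k²X² ≤ 2k'²X²`, so `|G₂Factor_p| ≤ exp(2k'²X²)`.
[cite: GoldstonPintzYildirim2009, Section 7 eq. 7.12] -/
theorem norm_G₂Factor_le_exp_sq {H₁ H₂ : Finset ℕ} (hk : 1 ≤ #H₁ + #H₂) {h p : ℕ} (hp : p.Prime)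
    (hpU : gpyU (2 * (#H₁ + #H₂)) h < p) (hΔ : ¬ p ∣ discr (H₁ ∪ H₂)) {s₁ s₂ : ℂ}
    (hδ : max (-s₁.re) 0 + max (-s₂.re) 0 ≤ 1 / 4) :
    ‖G₂Factor H₁ H₂ p s₁ s₂‖ ≤
      Real.exp (2 * ((2 * (#H₁ + #H₂) : ℕ) : ℝ) ^ 2 *
        ((p : ℝ) ^ (-(1 + -(max (-s₁.re) 0 + max (-s₂.re) 0)))) ^ 2) := by
  set δ : ℝ := max (-s₁.re) 0 + max (-s₂.re) 0 with hδdef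
  set X : ℝ := (p : ℝ) ^ (-(1 + -δ)) with hXdef
  set k : ℕ := #H₁ + #H₂ with hkdef
  have hp0 := hp.pos
  obtain ⟨hx, hy, hz⟩ := norms_le_rpow_delta hp0 s₁ s₂
  rw [← hδdef] at hx hy hz
  have hδ0 : 0 ≤ δ := add_nonneg (le_max_right _ _) (le_max_right _ _)
  have hX0 : 0 ≤ X := by positivity
  -- `k' X ≤ 1/2`, i.e. `2kX ≤ 1/2`
  have hkX : ((2 * (#H₁ + #H₂) : ℕ) : ℝ) * X ≤ 1 / 2 :=
    card_mul_rpow_le_half (k := 2 * (#H₁ + #H₂)) hpU (σ := -δ) (by linarith)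
  have hkk : ((2 * (#H₁ + #H₂) : ℕ) : ℝ) = 2 * ((#H₁ + #H₂ : ℕ) : ℝ) := by push_cast; ring
  have hX2 : 2 * ((#H₁ + #H₂ : ℕ) : ℝ) * X ≤ 1 / 2 := by rw [← hkk]; exact hkX
  have hk1 : (1 : ℝ) ≤ ((#H₁ + #H₂ : ℕ) : ℝ) := by exact_mod_cast hk
  have hXhalf : X ≤ 1 / 2 := by nlinarith
  have hr : #(H₁ ∩ H₂) ≤ #H₁ := Finset.card_le_card Finset.inter_subset_left
  have hgen := isGeneric_of_not_dvd_discr (H₁ := H₁) (H₂ := H₂) hΔ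
  -- the smallness of `w`
  have hw : ‖(#H₁ : ℂ) * (p : ℂ) ^ (-(1 + s₁)) + #H₂ * (p : ℂ) ^ (-(1 + s₂)) -
      #(H₁ ∩ H₂) * (p : ℂ) ^ (-(1 + s₁ + s₂))‖ ≤ 1 / 2 := by
    have hr' : (#(H₁ ∩ H₂) : ℝ) ≤ #H₁ := by exact_mod_cast hr
    calc ‖(#H₁ : ℂ) * (p : ℂ) ^ (-(1 + s₁)) + #H₂ * (p : ℂ) ^ (-(1 + s₂)) -
          #(H₁ ∩ H₂) * (p : ℂ) ^ (-(1 + s₁ + s₂))‖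
        ≤ ‖(#H₁ : ℂ) * (p : ℂ) ^ (-(1 + s₁)) + #H₂ * (p : ℂ) ^ (-(1 + s₂))‖ +
            ‖(#(H₁ ∩ H₂) : ℂ) * (p : ℂ) ^ (-(1 + s₁ + s₂))‖ := norm_sub_le _ _
      _ ≤ ‖(#H₁ : ℂ) * (p : ℂ) ^ (-(1 + s₁))‖ + ‖(#H₂ : ℂ) * (p : ℂ) ^ (-(1 + s₂))‖ +
            ‖(#(H₁ ∩ H₂) : ℂ) * (p : ℂ) ^ (-(1 + s₁ + s₂))‖ := by gcongr; exact norm_add_le _ _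
      _ = #H₁ * ‖(p : ℂ) ^ (-(1 + s₁))‖ + #H₂ * ‖(p : ℂ) ^ (-(1 + s₂))‖ +
            #(H₁ ∩ H₂) * ‖(p : ℂ) ^ (-(1 + s₁ + s₂))‖ := by
          simp only [norm_mul, Complex.norm_natCast]
      _ ≤ #H₁ * X + #H₂ * X + #H₁ * X := by gcongr
      _ ≤ 2 * ((#H₁ + #H₂ : ℕ) : ℝ) * X := by push_cast; nlinarith
      _ ≤ 1 / 2 := hX2
  rw [G₂Factor_eq_exp_of_isGeneric hgen hw (hx.trans hXhalf) (hy.trans hXhalf) (hz.trans hXhalf)]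
  refine (Complex.norm_exp_le_exp_norm _).trans (Real.exp_le_exp.2 ?_)
  refine (norm_g₂Log_le hr hk hx hy hz hX2).trans ?_
  rw [hkk]
  nlinarith [sq_nonneg X, sq_nonneg (((#H₁ + #H₂ : ℕ) : ℝ))]

/-- Sum over the primes `p > U'` dividing `Δ(H)`, for any `k' ≥ |H|` and `U' = gpyU k' h`:
at most `log₂ Δ ≤ U'/log 2` of them, each contributing `≤ 4k' U'^{δ−1}`: `∑ ≤ 6k'U'^δ`
(the one-variable `sum_dvd_le` with `k'` in place of `|H|`, using `log Δ(H) ≤ gpyU |H| h ≤ gpyU k' h`).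
[cite: GoldstonPintzYildirim2009, Section 6 eq. 6.16] -/
theorem sum_dvd_le_of_card_le {H : Finset ℕ} {k' : ℕ} (hk' : #H ≤ k') {h : ℕ} (hh : ∀ x ∈ H, x ≤ h)
    {σ : ℝ} (hσ : -1 / 4 ≤ σ) (S : Finset Nat.Primes) :
    ∑ p ∈ S.filter (fun p : Nat.Primes => gpyU k' h < ((p : ℕ) : ℝ) ∧ (p : ℕ) ∣ discr H),
        4 * (k' : ℝ) * (p : ℝ) ^ (-(1 + σ)) ≤ 6 * k' * gpyU k' h ^ (max (-σ) 0) := by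
  set U := gpyU k' h with hUdef
  set δ := max (-σ) 0 with hδdef
  have hU := gpyU_pos k' h
  have hδ0 : 0 ≤ δ := le_max_right _ _
  have hδ4 : δ ≤ 1 / 4 := max_le (by linarith) (by norm_num)
  set S₂ := S.filter (fun p : Nat.Primes => U < ((p : ℕ) : ℝ) ∧ (p : ℕ) ∣ discr H) with hS₂
  have hterm : ∀ p ∈ S₂, 4 * (k' : ℝ) * (p : ℝ) ^ (-(1 + σ)) ≤ 4 * k' * U ^ (δ - 1) := by
    intro p hp
    have hpU : U < (p : ℝ) := (Finset.mem_filter.1 hp).2.1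
    have hp1 : (1 : ℝ) ≤ p := by exact_mod_cast p.2.one_lt.le
    refine mul_le_mul_of_nonneg_left ?_ (by positivity)
    calc (p : ℝ) ^ (-(1 + σ)) ≤ (p : ℝ) ^ (δ - 1) :=
          Real.rpow_le_rpow_of_exponent_le hp1 (by linarith [le_max_left (-σ) 0])
      _ ≤ U ^ (δ - 1) := Real.rpow_le_rpow_of_nonpos hU hpU.le (by linarith)
  refine (Finset.sum_le_sum hterm).trans ?_
  rw [Finset.sum_const, nsmul_eq_mul]
  have hcard : (S₂.card : ℝ) ≤ U / Real.log 2 := by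
    have hΔ0 : discr H ≠ 0 := (discr_pos H).ne'
    have hsub : S₂.map ⟨Subtype.val, Nat.Primes.coe_nat_injective⟩ ⊆ (discr H).primeFactors := by
      intro q hq
      obtain ⟨p, hp, rfl⟩ := Finset.mem_map.1 hq
      exact Nat.mem_primeFactors.2 ⟨p.2, (Finset.mem_filter.1 hp).2.2, hΔ0⟩
    have h1 : S₂.card ≤ (discr H).primeFactors.card :=
      calc S₂.card = (S₂.map ⟨Subtype.val, Nat.Primes.coe_nat_injective⟩).card :=
            (Finset.card_map _).symm
        _ ≤ (discr H).primeFactors.card := Finset.card_le_card hsub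
    have h2 : ((discr H).primeFactors.card : ℝ) * Real.log 2 ≤ Real.log (discr H) := by
      rw [← Real.log_pow]
      exact Real.log_le_log (by positivity) (by exact_mod_cast two_pow_card_primeFactors_le hΔ0)
    have hlog2 : 0 < Real.log 2 := Real.log_pos one_lt_two
    rw [le_div_iff₀ hlog2]
    calc (S₂.card : ℝ) * Real.log 2 ≤ (discr H).primeFactors.card * Real.log 2 := by gcongr
      _ ≤ Real.log (discr H) := h2
      _ ≤ gpyU #H h := log_discr_le_gpyU hh
      _ ≤ U := gpyU_mono hk' h
  have hlog2 : Real.log 2 > 0.6931471803 := Real.log_two_gt_d9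
  have hUδ : U ^ (δ - 1) * U = U ^ δ := by
    rw [Real.rpow_sub_one hU.ne', div_mul_cancel₀ _ hU.ne']
  calc (S₂.card : ℝ) * (4 * k' * U ^ (δ - 1)) ≤ U / Real.log 2 * (4 * k' * U ^ (δ - 1)) :=
        mul_le_mul_of_nonneg_right hcard (by positivity)
    _ = (4 / Real.log 2) * k' * (U ^ (δ - 1) * U) := by ring
    _ = (4 / Real.log 2) * k' * U ^ δ := by rw [hUδ]
    _ ≤ 6 * k' * U ^ δ := by
        have : 4 / Real.log 2 ≤ 6 := by rw [div_le_iff₀ (by linarith)]; linarith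
        gcongr

/-- Finite partial products: for every finite set `S` of primes and `δ = δ₁ + δ₂ ≤ 1/4`,
`∏_{p ∈ S} |G₂Factor_p(s₁,s₂)| ≤ exp(k' U'^δ (4 log log U' + 25))`, `k' = 2(k₁+k₂)`,
`U' = gpyU k' h`. [cite: GoldstonPintzYildirim2009, Section 7 eq. 7.12] -/
theorem prod_norm_G₂Factor_le {H₁ H₂ : Finset ℕ} (hk : 1 ≤ #H₁ + #H₂) {h : ℕ}
    (hh : ∀ x ∈ H₁ ∪ H₂, x ≤ h) {s₁ s₂ : ℂ} (hδ : max (-s₁.re) 0 + max (-s₂.re) 0 ≤ 1 / 4)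
    (S : Finset Nat.Primes) :
    ∏ p ∈ S, ‖G₂Factor H₁ H₂ p s₁ s₂‖ ≤
      Real.exp ((2 * (#H₁ + #H₂) : ℕ) * gpyU (2 * (#H₁ + #H₂)) h ^ (max (-s₁.re) 0 + max (-s₂.re) 0) *
        (4 * Real.log (Real.log (gpyU (2 * (#H₁ + #H₂)) h)) + 25)) := by
  set k' : ℕ := 2 * (#H₁ + #H₂) with hk'def
  set U := gpyU k' h with hUdef
  set δ : ℝ := max (-s₁.re) 0 + max (-s₂.re) 0 with hδdef
  set σ : ℝ := -δ with hσdef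
  have hU := gpyU_pos k' h
  have hδ0 : 0 ≤ δ := add_nonneg (le_max_right _ _) (le_max_right _ _)
  have hσ : -1 / 4 ≤ σ := by rw [hσdef]; linarith
  have hmax : max (-σ) 0 = δ := by rw [hσdef, neg_neg, max_eq_left hδ0]
  have hcardH : #(H₁ ∪ H₂) ≤ k' := by
    rw [hk'def]; have := Finset.card_union_le H₁ H₂; omega
  -- the three majorants
  set A : Nat.Primes → ℝ := fun p => if ((p : ℕ) : ℝ) ≤ U then
    4 * (k' : ℝ) * (p : ℝ) ^ (-(1 + σ)) else 0 with hA
  set B : Nat.Primes → ℝ := fun p => if U < ((p : ℕ) : ℝ) ∧ (p : ℕ) ∣ discr (H₁ ∪ H₂) then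
    4 * (k' : ℝ) * (p : ℝ) ^ (-(1 + σ)) else 0 with hB
  set C : Nat.Primes → ℝ := fun p => if U < ((p : ℕ) : ℝ) then
    2 * (k' : ℝ) ^ 2 * ((p : ℝ) ^ (-(1 + σ))) ^ 2 else 0 with hC
  have hσδ : -(1 + σ) = -(1 + -δ) := by rw [hσdef]
  have hterm : ∀ p : Nat.Primes, ‖G₂Factor H₁ H₂ p s₁ s₂‖ ≤ Real.exp (A p + B p + C p) := by
    intro p
    have hgen : ‖G₂Factor H₁ H₂ p s₁ s₂‖ ≤ Real.exp (4 * (k' : ℝ) * (p : ℝ) ^ (-(1 + σ))) := by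
      rw [hσδ, hk'def]; exact norm_G₂Factor_le_exp H₁ H₂ p.2 hδ
    by_cases hpU : ((p : ℕ) : ℝ) ≤ U
    · have hA' : A p = 4 * (k' : ℝ) * (p : ℝ) ^ (-(1 + σ)) := if_pos hpU
      have hB' : B p = 0 := if_neg (fun h' => not_lt.2 hpU h'.1)
      have hC' : C p = 0 := if_neg (not_lt.2 hpU)
      rw [hA', hB', hC', add_zero, add_zero]
      exact hgen
    · rw [not_le] at hpU
      have hA' : A p = 0 := if_neg (not_le.2 hpU)
      have hC' : C p = 2 * (k' : ℝ) ^ 2 * ((p : ℝ) ^ (-(1 + σ))) ^ 2 := if_pos hpU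
      by_cases hpΔ : (p : ℕ) ∣ discr (H₁ ∪ H₂)
      · have hB' : B p = 4 * (k' : ℝ) * (p : ℝ) ^ (-(1 + σ)) := if_pos ⟨hpU, hpΔ⟩
        rw [hA', hB', hC', zero_add]
        refine hgen.trans (Real.exp_le_exp.2 ?_)
        have : 0 ≤ 2 * (k' : ℝ) ^ 2 * ((p : ℝ) ^ (-(1 + σ))) ^ 2 :=
          mul_nonneg (mul_nonneg zero_le_two (sq_nonneg _)) (sq_nonneg _)
        linarith
      · have hB' : B p = 0 := if_neg (fun h' => hpΔ h'.2)
        rw [hA', hB', hC', zero_add, zero_add, hσδ, hk'def]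
        exact norm_G₂Factor_le_exp_sq hk p.2 hpU hpΔ hδ
  have h1 : ∏ p ∈ S, ‖G₂Factor H₁ H₂ p s₁ s₂‖ ≤ Real.exp (∑ p ∈ S, (A p + B p + C p)) := by
    rw [Real.exp_sum]
    exact Finset.prod_le_prod (fun p _ => norm_nonneg _) fun p _ => hterm p
  refine h1.trans (Real.exp_le_exp.2 ?_)
  rw [Finset.sum_add_distrib, Finset.sum_add_distrib]
  have hAs : ∑ p ∈ S, A p ≤ 4 * k' * U ^ δ * (Real.log (Real.log U) + 4) := by
    rw [hA, ← Finset.sum_filter, ← hmax]; exact sum_small_le k' h σ S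
  have hBs : ∑ p ∈ S, B p ≤ 6 * k' * U ^ δ := by
    rw [hB, ← Finset.sum_filter, ← hmax]; exact sum_dvd_le_of_card_le hcardH hh hσ S
  have hCs : ∑ p ∈ S, C p ≤ 3 * k' * U ^ δ := by
    rw [hC, ← Finset.sum_filter, ← hmax]; exact sum_large_le k' h hσ S
  have : 4 * k' * U ^ δ * (Real.log (Real.log U) + 4) + 6 * k' * U ^ δ + 3 * k' * U ^ δ =
      k' * U ^ δ * (4 * Real.log (Real.log U) + 25) := by ring
  linarith

/-- **GPY (7.12)** with explicit constants: for `−1/8 ≤ σ₁, σ₂` (so `δ = δ₁ + δ₂ ≤ 1/4`,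
`δᵢ = max(−σᵢ, 0)`), `k₁ + k₂ ≥ 1`, `H₁ ∪ H₂ ⊆ [0, h]`, `k' = 2(k₁+k₂)`, `U' = max(16, 4k'², k'² log 2h)`:
`|G(s₁,s₂)| ≤ exp(k' U'^{δ} (4 log log U' + 25))` — GPY's `G ≪ exp(CkU^{δ₁+δ₂} log log U)`.
[cite: GoldstonPintzYildirim2009, Section 7 eq. 7.12] -/
theorem norm_G₂_le {H₁ H₂ : Finset ℕ} (hk : 1 ≤ #H₁ + #H₂) {h : ℕ} (hh : ∀ x ∈ H₁ ∪ H₂, x ≤ h)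
    {s₁ s₂ : ℂ} (hs₁ : -1 / 8 ≤ s₁.re) (hs₂ : -1 / 8 ≤ s₂.re) :
    ‖G₂ H₁ H₂ s₁ s₂‖ ≤
      Real.exp ((2 * (#H₁ + #H₂) : ℕ) * gpyU (2 * (#H₁ + #H₂)) h ^ (max (-s₁.re) 0 + max (-s₂.re) 0) *
        (4 * Real.log (Real.log (gpyU (2 * (#H₁ + #H₂)) h)) + 25)) := by
  have hδ : max (-s₁.re) 0 + max (-s₂.re) 0 ≤ 1 / 4 := by
    have h1 : max (-s₁.re) 0 ≤ 1 / 8 := max_le (by linarith) (by norm_num)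
    have h2 : max (-s₂.re) 0 ≤ 1 / 8 := max_le (by linarith) (by norm_num)
    linarith
  have hz : ((s₁, s₂) : ℂ × ℂ) ∈ G₂Region := ⟨by show -1 / 4 < s₁.re; linarith, by show -1 / 4 < s₂.re; linarith⟩
  have hprod : HasProd (fun p : Nat.Primes => G₂Factor H₁ H₂ p s₁ s₂) (G₂ H₁ H₂ s₁ s₂) :=
    (multipliable_G₂Factor hk hz).hasProd
  have ht : Tendsto (fun S : Finset Nat.Primes => ‖∏ p ∈ S, G₂Factor H₁ H₂ p s₁ s₂‖) atTop
      (𝓝 ‖G₂ H₁ H₂ s₁ s₂‖) := (continuous_norm.tendsto _).comp hprod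
  refine le_of_tendsto' ht fun S => ?_
  rw [norm_prod]
  exact prod_norm_G₂Factor_le hk hh hδ S

/-- `|G(s₁,s₂)| ≤ exp(k'(4 log log U' + 25)) = (e^{25} (log U')⁴)^{k'}` when `σ₁, σ₂ ≥ 0` (`δ = 0`).
[cite: GoldstonPintzYildirim2009, Section 7 eq. 7.12] -/
theorem norm_G₂_le_of_re_nonneg {H₁ H₂ : Finset ℕ} (hk : 1 ≤ #H₁ + #H₂) {h : ℕ}
    (hh : ∀ x ∈ H₁ ∪ H₂, x ≤ h) {s₁ s₂ : ℂ} (hs₁ : 0 ≤ s₁.re) (hs₂ : 0 ≤ s₂.re) :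
    ‖G₂ H₁ H₂ s₁ s₂‖ ≤
      Real.exp ((2 * (#H₁ + #H₂) : ℕ) * (4 * Real.log (Real.log (gpyU (2 * (#H₁ + #H₂)) h)) + 25)) := by
  have h := norm_G₂_le hk hh (s₁ := s₁) (s₂ := s₂) (by linarith) (by linarith)
  rwa [max_eq_right (by linarith : -s₁.re ≤ 0), max_eq_right (by linarith : -s₂.re ≤ 0), add_zero,
    Real.rpow_zero, mul_one] at h

end Literature.NumberTheory.Sieve.GPY
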